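import Literature.NumberTheory.Sieve.HybridLargeSievePrimes
import Literature.NumberTheory.Sieve.BombieriFriedlanderIwaniecDispersion
import Literature.NumberTheory.LFunctions.IncompleteKloostermanSmooth
import Literature.Analysis.Fourier.SmoothWindowKernel
import Mathlib.Analysis.Calculus.BumpFunction.Basic
import HarnessLib

/-!
# Quadratic forms with Kloosterman sums (Deshouillers–Iwaniec 1982, Proposition 3, (1.25)–(1.26))

For the classical Kloosterman sum `S(m, n; c)` (the tree's `Literature.NumberTheory.LFunctions.kloostermanSum`;
for the Hecke congruence group `Γ₀(q)` these are the Kloosterman sums `S_∞∞(m, n; c)`, `c ≡ 0 (q)`, of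
the cusp pair `(∞, ∞)`, and also `S_00(m, n; c)` for Iwaniec's Fricke scaling of the cusp `0`), a real
`θ`, a modulus `c ≥ 1`, `N ≥ 1/2` and coefficients `b`, Deshouillers–Iwaniec [DeshouillersIwaniec1982,
Proposition 3 p. 229 and §5.1 pp. 255–257] bound the quadratic form

  `B(θ, c, N) = ∑_{N < m, n ≤ 2N} b_m b̄_n S(m, n; c) e(2√(mn) θ/c)`      (`quadB θ c N b`)

in three ways: (1.25) `|B| ≤ τ(c)² c^{1/2} N ‖b‖²` (Weil's bound), (1.26) `|B| ≪ (c + N + √(θcN)) ‖b‖²`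
(a hybrid large sieve for the Farey points `d/c`), (1.27) `|B| ≪_ε θ^{-1/2} c^{1/2} N^{1/2+ε} ‖b‖²`
for `θ < 2`, `c < N` (Poisson summation).  These are the arithmetic input of the large-sieve
inequalities for Fourier coefficients of cusp forms [DeshouillersIwaniec1982, Theorem 2, §5.2–5.3].

This file PROVES (no named facts, no hypotheses):

* `norm_quadB_le_weil` — (1.25) with the constant `3`: `‖B‖ ≤ 3 τ(c)² √c N ‖b‖²`;
* `hybrid_largeSieve` — the hybrid large sieve (5.1) of [DeshouillersIwaniec1982, p. 255] ("We leave
  the proof of (5.1) to the reader as an exercise") in the form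
  `∫_{−Ξ}^{Ξ} ∑*_{d mod c} |∑_{m ∼ N} b_m m^{iξ} e(md/c)|² dξ ≤ π²(π e^π N + 2cΞ) ‖b‖²` (`Ξ ≥ 1`), by
  Gallagher's lemma (tree: `Gallagher.gallagher_lemma_general`) and the large sieve for the
  `1/c`-spaced points `d/c` (tree: `LargeSieve.largeSieve_wellSpaced`), as in
  `HybridLargeSievePrimes.lean`;
* `norm_quadB_le_largeSieve` — (1.26) in the form `‖B‖ ≤ A (c + N + |θ| N) ‖b‖²` with an absolute
  constant `A` (`quadBLSConst`).  We separate the variables in `e(2θ√(mn)/c)` by Fourier inversion on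
  the logarithmic scale (`u = log(mn/N²)`, a fixed smooth plateau `ρ` and `G(u) = ρ(u) e(κ e^{u/2})`,
  `κ = 2θN/c`, `|𝓕G(ξ)| ≤ min(‖G‖₁, ‖G''‖₁/(4π²ξ²))`, `‖G''‖₁ ≪ (1 + |κ|)²`) instead of the Mellin
  transform with the stationary-phase bound `M(1+it) ≪ (1+|t|)^{-1/2}` of the source; this loses
  `√(θcN) ↦ θN`, which is harmless in all uses in [DeshouillersIwaniec1982, §5] (there `θ = ch ξ`
  against `e^{-(ξK)²}`, or `θ ≤ 2`).

The third bound (1.27) is proved in the companion file `KloostermanQuadraticFormsShort.lean`.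

## References

* [DeshouillersIwaniec1982] J.-M. Deshouillers, H. Iwaniec, *Kloosterman sums and Fourier coefficients
  of cusp forms*, Invent. Math. 70 (1982), 219–288: Proposition 3 (1.25)–(1.27) p. 229; §5.1
  pp. 255–257, (5.1).
* [Iwaniec2002] H. Iwaniec, *Spectral Methods of Automorphic Forms*, GSM 53, (2.23)–(2.25) (Weil's bound,
  tree: `LFunctions.weil_kloosterman_bound_holds`).
* Gallagher 1970, Lemma 1 (tree: `Gallagher.gallagher_lemma_general`); the large sieve (tree:
  `LargeSieve.largeSieve_wellSpaced`).
-/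

noncomputable section

open Finset Real MeasureTheory Complex
open scoped ComplexConjugate FourierTransform ContDiff

namespace Literature.NumberTheory.Sieve

namespace DeshouillersIwaniec

open BFI LFunctions LargeSieve Gallagher

/-! ### The objects -/

/-- The classical Kloosterman sum `S(m, n; c) = ∑_{x ∈ (ℤ/cℤ)ˣ} e((m x + n x̄)/c)` as a total function of
the modulus (`0` for `c = 0`); the tree's `LFunctions.kloostermanSum`. [cite: Iwaniec2002, §2.5 (2.23)] -/
def kloo (m n : ℤ) (c : ℕ) : ℂ :=
  if h : c = 0 then 0 else (haveI : NeZero c := ⟨h⟩; kloostermanSum c (m : ZMod c) (n : ZMod c))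

/-- Unfolding `kloo` at a nonzero modulus. [folklore] -/
theorem kloo_of_neZero (m n : ℤ) (c : ℕ) [NeZero c] :
    kloo m n c = kloostermanSum c (m : ZMod c) (n : ZMod c) := by
  unfold kloo
  rw [dif_neg (NeZero.ne c)]

/-- **Weil's bound** for `kloo`: `‖S(m, n; c)‖ ≤ τ(c) √c √(m, c)` (from the tree's
`weil_kloosterman_bound_holds`: `≤ √(m,n,c) √c τ(c)` and `(m, n, c) ∣ (m, c)`). [cite: Iwaniec2002, §2.5 (2.25)] -/
theorem norm_kloo_le (m n : ℤ) {c : ℕ} (hc : 0 < c) :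
    ‖kloo m n c‖ ≤ (c.divisors.card : ℝ) * Real.sqrt c * Real.sqrt (Int.gcd m c) := by
  haveI : NeZero c := ⟨hc.ne'⟩
  rw [kloo_of_neZero]
  refine (weil_kloosterman_bound_holds c m n).trans ?_
  have hgcd : (Nat.gcd (Nat.gcd m.natAbs n.natAbs) c : ℝ) ≤ (Int.gcd m c : ℝ) := by
    have h1 : Nat.gcd (Nat.gcd m.natAbs n.natAbs) c ∣ Nat.gcd m.natAbs c :=
      Nat.gcd_dvd_gcd_of_dvd_left c (Nat.gcd_dvd_left _ _)
    have hI : Int.gcd m c = Nat.gcd m.natAbs c := by rw [Int.gcd_eq_natAbs, Int.natAbs_natCast]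
    rw [hI]
    exact_mod_cast Nat.le_of_dvd (Nat.gcd_pos_of_pos_right _ hc) h1
  calc Real.sqrt (Nat.gcd (Nat.gcd m.natAbs n.natAbs) c) * Real.sqrt c * c.divisors.card
      ≤ Real.sqrt (Int.gcd m c) * Real.sqrt c * c.divisors.card := by gcongr
    _ = _ := by ring

/-- `‖b‖² = ∑_{n ∼ N} |b_n|²` over the dyadic range `N < n ≤ 2N`. [folklore] -/
def l2 (N : ℝ) (b : ℕ → ℂ) : ℝ := ∑ n ∈ dyadic N, ‖b n‖ ^ 2

/-- `‖b‖² ≥ 0`. [folklore] -/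
theorem l2_nonneg (N : ℝ) (b : ℕ → ℂ) : 0 ≤ l2 N b := sum_nonneg fun _ _ => by positivity

/-- **The quadratic form with Kloosterman sums** of [DeshouillersIwaniec1982, Proposition 3 / §5.1]:
`B(θ, c, N) = ∑_{N < m, n ≤ 2N} b_m b̄_n S(m, n; c) e(2 √(mn) θ / c)`.
[cite: DeshouillersIwaniec1982, Proposition 3 p. 229] -/
def quadB (θ : ℝ) (c : ℕ) (N : ℝ) (b : ℕ → ℂ) : ℂ :=
  ∑ m ∈ dyadic N, ∑ n ∈ dyadic N,
    b m * conj (b n) * kloo m n c * e (2 * θ * Real.sqrt ((m : ℝ) * n) / c)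

/-- `x ≤ √y` from `x ≥ 0` and `x² ≤ y`. [folklore] -/
theorem le_sqrt_of_sq_le' {x y : ℝ} (hx : 0 ≤ x) (h : x ^ 2 ≤ y) : x ≤ Real.sqrt y :=
  calc x = Real.sqrt (x ^ 2) := (Real.sqrt_sq hx).symm
    _ ≤ Real.sqrt y := Real.sqrt_le_sqrt h

/-! ### (1.25): Weil's bound -/

/-- `∑_{m ∼ N} (m, c) ≤ 2 τ(c) N` (`N ≥ 0`, `c ≥ 1`), from `∑_{h ≤ L} (h, c) ≤ τ(c) L`. [folklore] -/
theorem sum_dyadic_gcd_le {N : ℝ} (hN : 0 ≤ N) {c : ℕ} (hc : c ≠ 0) :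
    ∑ m ∈ dyadic N, (Nat.gcd m c : ℝ) ≤ 2 * c.divisors.card * N := by
  have hsub : dyadic N ⊆ Icc 1 ⌊2 * N⌋₊ := by
    intro m hm
    have h := (mem_dyadic hN).1 hm
    rw [mem_Icc]
    refine ⟨?_, Nat.le_floor h.2⟩
    have : (0 : ℝ) < m := hN.trans_lt h.1
    exact_mod_cast this
  calc ∑ m ∈ dyadic N, (Nat.gcd m c : ℝ) ≤ ∑ m ∈ Icc 1 ⌊2 * N⌋₊, (Nat.gcd m c : ℝ) :=
        sum_le_sum_of_subset_of_nonneg hsub fun _ _ _ => by positivity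
    _ ≤ c.divisors.card * ⌊2 * N⌋₊ := MatomakiMerikoski.MatomakiMerikoski2023_lemma37_i hc _
    _ ≤ c.divisors.card * (2 * N) := by gcongr; exact Nat.floor_le (by linarith)
    _ = _ := by ring

/-- `#(dyadic N) ≤ 4N` for `N ≥ 1/2` (as `BFI.L1.card_dyadic_le_four_mul'`, reproved to keep the imports light). [folklore] -/
private theorem card_dyadic_le {N : ℝ} (hN : 1 / 2 ≤ N) : ((dyadic N).card : ℝ) ≤ 4 * N := by
  have hN0 : 0 ≤ N := by linarith
  have hsub : dyadic N ⊆ Icc 1 ⌊2 * N⌋₊ := by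
    intro m hm
    have h := (mem_dyadic hN0).1 hm
    rw [mem_Icc]
    refine ⟨?_, Nat.le_floor h.2⟩
    have : (0 : ℝ) < m := hN0.trans_lt h.1
    exact_mod_cast this
  calc ((dyadic N).card : ℝ) ≤ ((Icc 1 ⌊2 * N⌋₊).card : ℝ) := by exact_mod_cast card_le_card hsub
    _ = ⌊2 * N⌋₊ := by simp
    _ ≤ 2 * N := Nat.floor_le (by linarith)
    _ ≤ 4 * N := by linarith

/-- **(1.25)** [DeshouillersIwaniec1982, Proposition 3 (1.25)]: `‖B(θ, c, N)‖ ≤ 3 τ(c)² √c N ‖b‖²`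
(`c ≥ 1`, `N ≥ 1/2`; Weil's bound `|S(m,n;c)| ≤ τ(c) √c (m,c)^{1/2}`, Cauchy–Schwarz in `m` and in `n`,
`∑_{m∼N} (m, c) ≤ 2τ(c)N`, `#(n ∼ N) ≤ 4N`; the printed constant is `τ(c)²`).
[cite: DeshouillersIwaniec1982, Proposition 3 (1.25)] -/
theorem norm_quadB_le_weil (θ : ℝ) {c : ℕ} (hc : 1 ≤ c) {N : ℝ} (hN : 1 / 2 ≤ N) (b : ℕ → ℂ) :
    ‖quadB θ c N b‖ ≤ 3 * (c.divisors.card : ℝ) ^ 2 * Real.sqrt c * N * l2 N b := by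
  have hc0 : 0 < c := hc
  have hN0 : 0 ≤ N := by linarith
  set τ : ℝ := (c.divisors.card : ℝ) with hτ
  have hτ1 : 1 ≤ τ := by
    rw [hτ]; exact_mod_cast Finset.card_pos.2 ⟨1, Nat.one_mem_divisors.2 hc0.ne'⟩
  -- termwise Weil
  have hterm : ∀ m ∈ dyadic N, ∀ n ∈ dyadic N,
      ‖b m * conj (b n) * kloo m n c * e (2 * θ * Real.sqrt ((m : ℝ) * n) / c)‖ ≤
        τ * Real.sqrt c * ((‖b m‖ * Real.sqrt (Nat.gcd m c)) * ‖b n‖) := by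
    intro m _ n _
    rw [norm_mul, norm_mul, norm_mul, Circle.norm_coe, mul_one, norm_conj]
    have hW := norm_kloo_le (m : ℤ) (n : ℤ) hc0
    rw [Int.gcd_natCast_natCast] at hW
    calc ‖b m‖ * ‖b n‖ * ‖kloo m n c‖ ≤ ‖b m‖ * ‖b n‖ * (τ * Real.sqrt c * Real.sqrt (Nat.gcd m c)) := by
          gcongr
      _ = _ := by ring
  -- the two Cauchy–Schwarz inequalities
  have hCS1 : (∑ m ∈ dyadic N, ‖b m‖ * Real.sqrt (Nat.gcd m c)) ^ 2 ≤
      l2 N b * ∑ m ∈ dyadic N, (Nat.gcd m c : ℝ) := by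
    have h := sum_mul_sq_le_sq_mul_sq (dyadic N) (fun m => ‖b m‖) (fun m => Real.sqrt (Nat.gcd m c))
    refine h.trans (le_of_eq ?_)
    unfold l2
    congr 1
    exact sum_congr rfl fun m _ => Real.sq_sqrt (by positivity)
  have hCS2 : (∑ n ∈ dyadic N, ‖b n‖) ^ 2 ≤ l2 N b * (dyadic N).card := by
    have h := sum_mul_sq_le_sq_mul_sq (dyadic N) (fun n => ‖b n‖) (fun _ => (1 : ℝ))
    simp only [mul_one, one_pow, sum_const, nsmul_eq_mul] at h
    unfold l2
    exact h
  have hS1 : ∑ m ∈ dyadic N, ‖b m‖ * Real.sqrt (Nat.gcd m c) ≤ Real.sqrt (l2 N b * (2 * τ * N)) :=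
    le_sqrt_of_sq_le' (sum_nonneg fun _ _ => by positivity)
      (hCS1.trans (mul_le_mul_of_nonneg_left (sum_dyadic_gcd_le hN0 hc0.ne') (l2_nonneg N b)))
  have hS2 : ∑ n ∈ dyadic N, ‖b n‖ ≤ Real.sqrt (l2 N b * (4 * N)) :=
    le_sqrt_of_sq_le' (sum_nonneg fun _ _ => by positivity)
      (hCS2.trans (mul_le_mul_of_nonneg_left (card_dyadic_le hN) (l2_nonneg N b)))
  have h83 : Real.sqrt (8 * τ) ≤ 3 * τ := by
    rw [Real.sqrt_le_left (by positivity)]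
    nlinarith
  -- assemble
  have hl2 := l2_nonneg N b
  calc ‖quadB θ c N b‖
      ≤ ∑ m ∈ dyadic N, ∑ n ∈ dyadic N,
          ‖b m * conj (b n) * kloo m n c * e (2 * θ * Real.sqrt ((m : ℝ) * n) / c)‖ := by
        unfold quadB
        exact (norm_sum_le _ _).trans (sum_le_sum fun m _ => norm_sum_le _ _)
    _ ≤ ∑ m ∈ dyadic N, ∑ n ∈ dyadic N, τ * Real.sqrt c * ((‖b m‖ * Real.sqrt (Nat.gcd m c)) * ‖b n‖) :=
        sum_le_sum fun m hm => sum_le_sum fun n hn => hterm m hm n hn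
    _ = τ * Real.sqrt c * ((∑ m ∈ dyadic N, ‖b m‖ * Real.sqrt (Nat.gcd m c)) * ∑ n ∈ dyadic N, ‖b n‖) := by
        rw [sum_mul, mul_sum]
        refine sum_congr rfl fun m _ => ?_
        rw [mul_sum, mul_sum]
    _ ≤ τ * Real.sqrt c * (Real.sqrt (l2 N b * (2 * τ * N)) * Real.sqrt (l2 N b * (4 * N))) := by
        have h0 : 0 ≤ ∑ n ∈ dyadic N, ‖b n‖ := sum_nonneg fun _ _ => by positivity
        have h0' : 0 ≤ Real.sqrt (l2 N b * (2 * τ * N)) := Real.sqrt_nonneg _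
        have := mul_le_mul hS1 hS2 h0 h0'
        exact mul_le_mul_of_nonneg_left this (by positivity)
    _ = τ * Real.sqrt c * (l2 N b * N * Real.sqrt (8 * τ)) := by
        rw [← Real.sqrt_mul (by positivity)]
        have : l2 N b * (2 * τ * N) * (l2 N b * (4 * N)) = (l2 N b * N) ^ 2 * (8 * τ) := by ring
        rw [this, Real.sqrt_mul (by positivity), Real.sqrt_sq (by positivity)]
    _ ≤ τ * Real.sqrt c * (l2 N b * N * (3 * τ)) := by gcongr
    _ = 3 * τ ^ 2 * Real.sqrt c * N * l2 N b := by ring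

/-! ### The hybrid large sieve for the Farey points `d/c` ((5.1) of the source) -/

/-- `t ↦ e(t)` is continuous as a complex-valued function. [folklore] -/
theorem continuous_e_coe : Continuous fun t : ℝ => (𝐞 t : ℂ) :=
  continuous_subtype_val.comp Real.continuous_fourierChar

/-- The reduced residues `0 ≤ d < c`, `(d, c) = 1`. [folklore] -/
def units (c : ℕ) : Finset ℕ := (range c).filter fun d => d.Coprime c

/-- The points `d/c`, `d ∈ units c`, are `1/c`-spaced modulo `1`. [folklore] -/
theorem units_spacing {c : ℕ} (hc : 1 ≤ c) {d d' : ℕ} (hd : d ∈ units c) (hd' : d' ∈ units c)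
    (hne : d ≠ d') (k : ℤ) : (c : ℝ)⁻¹ ≤ |(d' : ℝ) / c - (d : ℝ) / c - k| := by
  have hc0 : (0 : ℝ) < c := by exact_mod_cast hc
  rw [units, mem_filter, mem_range] at hd hd'
  have hint : (d' : ℝ) / c - (d : ℝ) / c - k = ((d' : ℤ) - d - k * c : ℤ) / (c : ℝ) := by
    push_cast; field_simp
  rw [hint, abs_div, abs_of_pos hc0, le_div_iff₀ hc0, inv_mul_cancel₀ hc0.ne']
  have hne0 : ((d' : ℤ) - d - k * c : ℤ) ≠ 0 := by
    intro h
    have hmod : ((d' : ℤ) : ZMod c) = ((d : ℤ) : ZMod c) := by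
      rw [ZMod.intCast_eq_intCast_iff_dvd_sub]
      exact ⟨-k, by linarith⟩
    rw [Int.cast_natCast, Int.cast_natCast] at hmod
    have := (ZMod.natCast_eq_natCast_iff' d' d c).1 hmod
    rw [Nat.mod_eq_of_lt hd'.1, Nat.mod_eq_of_lt hd.1] at this
    exact hne this.symm
  have : (1 : ℝ) ≤ |((d' : ℤ) - d - k * c : ℤ)| := by
    exact_mod_cast Int.one_le_abs hne0
  simpa using this

open scoped Classical in
/-- **One window** (cf. `LargeSieve.window_bound`): for every real `x`, with
`W_x = {m ∼ N : x ≤ ν_m ≤ x + δ}`, `ν_m = (log m)/2π`,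
`∑*_{d mod c} |Ξ ∑_{m ∈ W_x} b_m e(md/c)|² ≤ ∑_{m∼N} |b_m|² K 𝟙_{[ν_m − δ, ν_m]}(x)`,
`K = Ξ²((e^{2πδ} − 1)2N + 2 + 2c)` (the large sieve for the `1/c`-spaced points `d/c` on the integer
interval containing the window). [cite: DeshouillersIwaniec1982, §5.1 (5.1)] -/
theorem window_bound_farey {c : ℕ} (hc : 1 ≤ c) {N : ℝ} (hN : 0 ≤ N) (b : ℕ → ℂ) {Ξ δ : ℝ}
    (hδ : 0 < δ) (x : ℝ) :
    ∑ d ∈ units c, ‖(Ξ : ℂ) * ∑ m ∈ (dyadic N).filter (fun m => x ≤ logFreq m ∧ logFreq m ≤ x + δ),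
        b m * e ((m : ℝ) * ((d : ℝ) / c))‖ ^ 2 ≤
      ∑ m ∈ dyadic N, ‖b m‖ ^ 2 * (Ξ ^ 2 * ((Real.exp (2 * π * δ) - 1) * (2 * N) + 2 + 2 * c)) *
        (Set.Icc (logFreq m - δ) (logFreq m)).indicator (fun _ => (1 : ℝ)) x := by
  set Wx : Finset ℕ := (dyadic N).filter (fun m => x ≤ logFreq m ∧ logFreq m ≤ x + δ) with hWx
  have hc0 : (0 : ℝ) < c := by exact_mod_cast hc
  -- the integer interval containing the window
  set M₀ : ℕ := ⌈Real.exp (2 * π * x)⌉₊ - 1 with hM₀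
  set N' : ℕ := ⌊Real.exp (2 * π * (x + δ))⌋₊ + 1 - ⌈Real.exp (2 * π * x)⌉₊ with hN'
  have hexp0 : 0 < Real.exp (2 * π * x) := Real.exp_pos _
  have hceil1 : 1 ≤ ⌈Real.exp (2 * π * x)⌉₊ := Nat.one_le_cast.1 ((Nat.one_le_cast.2 le_rfl).trans
    (by exact_mod_cast Nat.lt_ceil.2 (by simpa using hexp0) : (1 : ℕ) ≤ ⌈Real.exp (2 * π * x)⌉₊))
  have hmem1 : ∀ m ∈ Wx, 1 ≤ m := by
    intro m hm
    rw [hWx, mem_filter] at hm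
    exact pos_of_mem_dyadic hN hm.1
  have hWin : ∀ m ∈ Wx, M₀ < m ∧ m ≤ M₀ + N' := by
    intro m hm
    have hm1 := hmem1 m hm
    rw [hWx, mem_filter] at hm
    obtain ⟨h1, h2⟩ := exp_le_of_logFreq_window hm1 hm.2
    have hc' : ⌈Real.exp (2 * π * x)⌉₊ ≤ m := Nat.ceil_le.2 h1
    have hf : m ≤ ⌊Real.exp (2 * π * (x + δ))⌋₊ := Nat.le_floor h2
    constructor <;> omega
  -- the integer sequence
  set a : ℤ → ℂ := fun n => if 0 ≤ n ∧ n.toNat ∈ Wx then (Ξ : ℂ) * b n.toNat else 0 with ha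
  have ha_nat : ∀ m : ℕ, a m = if m ∈ Wx then (Ξ : ℂ) * b m else 0 := by
    intro m
    rw [ha]; dsimp only
    simp only [Int.toNat_natCast, Int.natCast_nonneg, true_and]
  have himage : ∀ (f : ℤ → ℂ), (∀ n ∈ Ioc (M₀ : ℤ) (M₀ + N'), a n = 0 → f n = 0) →
      ∑ n ∈ Ioc (M₀ : ℤ) (M₀ + N'), f n = ∑ m ∈ Wx, f m := by
    intro f hf
    have hsub : Wx.image (fun m : ℕ => (m : ℤ)) ⊆ Ioc (M₀ : ℤ) (M₀ + N') := by
      intro n hn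
      rw [mem_image] at hn
      obtain ⟨m, hm, rfl⟩ := hn
      have := hWin m hm
      rw [mem_Ioc]; constructor <;> omega
    rw [← sum_subset hsub, sum_image (fun p _ p' _ h => by exact_mod_cast h)]
    intro n hn hnot
    refine hf n hn ?_
    rw [ha]; dsimp only
    rw [if_neg]
    rintro ⟨h0, hWn⟩
    apply hnot
    rw [mem_image]
    exact ⟨n.toNat, hWn, Int.toNat_of_nonneg h0⟩
  have hsumd : ∀ d : ℕ, ∑ n ∈ Ioc (M₀ : ℤ) (M₀ + N'), a n * e (n * ((d : ℝ) / c)) =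
      (Ξ : ℂ) * ∑ m ∈ Wx, b m * e ((m : ℝ) * ((d : ℝ) / c)) := by
    intro d
    rw [himage (fun n => a n * e (n * ((d : ℝ) / c))) (fun n _ h0 => by rw [h0, zero_mul]), mul_sum]
    refine sum_congr rfl fun m hm => ?_
    rw [ha_nat, if_pos hm, Int.cast_natCast, mul_assoc]
  have hnorm : ∑ n ∈ Ioc (M₀ : ℤ) (M₀ + N'), ‖a n‖ ^ 2 = ∑ m ∈ Wx, Ξ ^ 2 * ‖b m‖ ^ 2 := by
    have := himage (fun n => ((‖a n‖ ^ 2 : ℝ) : ℂ)) (fun n _ h0 => by rw [h0]; simp)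
    have h2 : ∀ m ∈ Wx, ((‖a m‖ ^ 2 : ℝ) : ℂ) = ((Ξ ^ 2 * ‖b m‖ ^ 2 : ℝ) : ℂ) := by
      intro m hm
      rw [ha_nat, if_pos hm, norm_mul, Complex.norm_real, Real.norm_eq_abs, mul_pow, sq_abs]
    rw [sum_congr rfl h2] at this
    exact_mod_cast this
  -- the large sieve for the points `d/c`
  have hδ' : (0 : ℝ) < (c : ℝ)⁻¹ := by positivity
  have hls := largeSieve_wellSpaced (units c) (fun d : ℕ => (d : ℝ) / c) hδ'
    (fun d hd d' hd' hne k => units_spacing hc hd hd' hne k) a M₀ N'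
  simp only [hsumd, hnorm] at hls
  refine hls.trans ?_
  -- bound `N'`
  have hNle : (N' : ℝ) ≤ (Real.exp (2 * π * δ) - 1) * Real.exp (2 * π * x) + 1 := by
    have hprod : Real.exp (2 * π * (x + δ)) = Real.exp (2 * π * δ) * Real.exp (2 * π * x) := by
      rw [← Real.exp_add]; congr 1; ring
    by_cases hle : ⌈Real.exp (2 * π * x)⌉₊ ≤ ⌊Real.exp (2 * π * (x + δ))⌋₊ + 1
    · have h1' : (⌊Real.exp (2 * π * (x + δ))⌋₊ : ℝ) ≤ Real.exp (2 * π * (x + δ)) :=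
        Nat.floor_le (Real.exp_pos _).le
      have h1 := h1'.trans (le_of_eq hprod)
      have h2 : Real.exp (2 * π * x) ≤ ⌈Real.exp (2 * π * x)⌉₊ := Nat.le_ceil _
      have hNeq : (N' : ℝ) = (⌊Real.exp (2 * π * (x + δ))⌋₊ : ℝ) + 1 - ⌈Real.exp (2 * π * x)⌉₊ := by
        rw [hN', Nat.cast_sub hle]; push_cast; ring
      rw [hNeq]
      calc (⌊Real.exp (2 * π * (x + δ))⌋₊ : ℝ) + 1 - ⌈Real.exp (2 * π * x)⌉₊
          ≤ Real.exp (2 * π * δ) * Real.exp (2 * π * x) + 1 - Real.exp (2 * π * x) := by linarith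
        _ = (Real.exp (2 * π * δ) - 1) * Real.exp (2 * π * x) + 1 := by ring
    · have : N' = 0 := by rw [hN']; omega
      rw [this, Nat.cast_zero]
      have : 0 ≤ (Real.exp (2 * π * δ) - 1) * Real.exp (2 * π * x) := by
        refine mul_nonneg ?_ (Real.exp_pos _).le
        linarith [Real.exp_le_exp.2 (show (0:ℝ) ≤ 2 * π * δ by positivity), Real.exp_zero]
      linarith
  have hexpδ : 0 ≤ Real.exp (2 * π * δ) - 1 := by
    linarith [Real.exp_le_exp.2 (show (0:ℝ) ≤ 2 * π * δ by positivity), Real.exp_zero]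
  -- termwise comparison
  have hterm : ∀ m ∈ Wx, ((N' : ℝ) + 1 + 2 * c) * (Ξ ^ 2 * ‖b m‖ ^ 2) ≤
      ‖b m‖ ^ 2 * (Ξ ^ 2 * ((Real.exp (2 * π * δ) - 1) * (2 * N) + 2 + 2 * c)) := by
    intro m hm
    have hm' := hm
    rw [hWx, mem_filter] at hm'
    have hm1 : 1 ≤ m := hmem1 m hm
    obtain ⟨h1, -⟩ := exp_le_of_logFreq_window hm1 hm'.2
    have hm2N : (m : ℝ) ≤ 2 * N := ((mem_dyadic hN).1 hm'.1).2
    have hN2 : (N' : ℝ) + 1 + 2 * c ≤ (Real.exp (2 * π * δ) - 1) * (2 * N) + 2 + 2 * c := by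
      nlinarith [mul_le_mul_of_nonneg_left (h1.trans hm2N) hexpδ]
    have hb : 0 ≤ Ξ ^ 2 * ‖b m‖ ^ 2 := by positivity
    calc ((N' : ℝ) + 1 + 2 * c) * (Ξ ^ 2 * ‖b m‖ ^ 2)
        ≤ ((Real.exp (2 * π * δ) - 1) * (2 * N) + 2 + 2 * c) * (Ξ ^ 2 * ‖b m‖ ^ 2) :=
          mul_le_mul_of_nonneg_right hN2 hb
      _ = _ := by ring
  have hc2 : ((N' : ℝ) + 1 + 2 * c) = ((N' : ℝ) + 1 + 2 / (c : ℝ)⁻¹) := by rw [div_inv_eq_mul]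
  rw [← hc2, mul_sum]
  refine (sum_le_sum hterm).trans ?_
  -- from `Wx` to `dyadic N` with the indicator
  rw [hWx, sum_filter]
  refine sum_le_sum fun m _ => ?_
  by_cases hw : x ≤ logFreq m ∧ logFreq m ≤ x + δ
  · rw [if_pos hw, Set.indicator_of_mem (by rw [Set.mem_Icc]; constructor <;> linarith [hw.1, hw.2]),
      mul_one]
  · rw [if_neg hw, Set.indicator_of_notMem (by
      rw [Set.mem_Icc]; intro h'; exact hw ⟨h'.2, by linarith [h'.1]⟩), mul_zero]

/-- `(e^{2πδ} − 1) Ξ ≤ π e^π` for `δ = (2Ξ)⁻¹`, `Ξ ≥ 1`. [folklore] -/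
theorem exp_window_factor_le {Ξ : ℝ} (hΞ : 1 ≤ Ξ) :
    (Real.exp (2 * π * (2 * Ξ)⁻¹) - 1) * Ξ ≤ π * Real.exp π := by
  have hΞ0 : 0 < Ξ := by linarith
  have hu : 2 * π * (2 * Ξ)⁻¹ = π / Ξ := by field_simp
  rw [hu]
  have hu0 : 0 ≤ π / Ξ := by positivity
  have hu1 : π / Ξ ≤ π := div_le_self Real.pi_pos.le hΞ
  have h1 : Real.exp (π / Ξ) - 1 ≤ (π / Ξ) * Real.exp π :=
    (exp_sub_one_le_mul_exp _).trans (mul_le_mul_of_nonneg_left (Real.exp_le_exp.2 hu1) hu0)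
  have h2 := mul_le_mul_of_nonneg_right h1 hΞ0.le
  calc (Real.exp (π / Ξ) - 1) * Ξ ≤ (π / Ξ) * Real.exp π * Ξ := h2
    _ = π * Real.exp π := by field_simp

/-- **The hybrid large sieve for the Farey points `d/c`** [DeshouillersIwaniec1982, (5.1) p. 255:
"`∫_{−T}^{T} ∑*_{d mod c} |∑_{N<n≤2N} b_n n^{it} e(nd/c)|² dt ≪ (cT + N)‖b_N‖²`. We leave the proof of
(5.1) to the reader as an exercise"], here with explicit constants and the frequency normalisation
`m^{iξ} = e(ν_m ξ)`, `ν_m = (log m)/2π` (`LargeSieve.fourierChar_logFreq_mul`): for `c ≥ 1`, `N ≥ 0`,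
`Ξ ≥ 1` and any `b`,
`∫_{−Ξ}^{Ξ} ∑*_{d mod c} |∑_{m∼N} b_m e(md/c) e(ν_m ξ)|² dξ ≤ π²(π e^π N + 2cΞ) ‖b‖²`.
Proof: Gallagher's lemma in `ξ` for each `d`, then the large sieve for the `1/c`-spaced points `d/c` on
each window (an integer interval of length `≤ (e^{π/Ξ} − 1) 2N + 1`), exactly as Bombieri/Gallagher prove
the hybrid sieve for characters (`LargeSieve.hybridSieve_primes`). [cite: DeshouillersIwaniec1982, §5.1 (5.1)] -/
theorem hybrid_largeSieve {c : ℕ} (hc : 1 ≤ c) {N : ℝ} (hN : 0 ≤ N) {Ξ : ℝ} (hΞ : 1 ≤ Ξ) (b : ℕ → ℂ) :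
    ∫ ξ in (-Ξ)..Ξ, ∑ d ∈ units c,
        ‖∑ m ∈ dyadic N, b m * e ((m : ℝ) * ((d : ℝ) / c)) * e (logFreq m * ξ)‖ ^ 2 ≤
      π ^ 2 * (π * Real.exp π * N + 2 * c * Ξ) * l2 N b := by
  have hΞ0 : 0 < Ξ := by linarith
  set δ : ℝ := (2 * Ξ)⁻¹ with hδ
  have hδ0 : 0 < δ := by rw [hδ]; positivity
  set K : ℝ := Ξ ^ 2 * ((Real.exp (2 * π * δ) - 1) * (2 * N) + 2 + 2 * c) with hK
  -- Step 1: Gallagher's lemma for each `d`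
  have hG : ∀ d : ℕ, ∫ ξ in (-Ξ)..Ξ,
      ‖∑ m ∈ dyadic N, b m * e ((m : ℝ) * ((d : ℝ) / c)) * e (logFreq m * ξ)‖ ^ 2 ≤
        π ^ 2 * ∫ x : ℝ, ‖(Ξ : ℂ) * ∑ m ∈ (dyadic N).filter (fun m => x ≤ logFreq m ∧ logFreq m ≤ x + δ),
          b m * e ((m : ℝ) * ((d : ℝ) / c))‖ ^ 2 := by
    intro d
    have h := gallagher_lemma_general (dyadic N) logFreq (fun m => b m * e ((m : ℝ) * ((d : ℝ) / c))) hΞ0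
    rw [← hδ] at h
    exact h
  -- Step 2: sum over `d`, sums inside the integral
  have hint : ∀ d : ℕ, Integrable fun x : ℝ =>
      ‖(Ξ : ℂ) * ∑ m ∈ (dyadic N).filter (fun m => x ≤ logFreq m ∧ logFreq m ≤ x + δ),
        b m * e ((m : ℝ) * ((d : ℝ) / c))‖ ^ 2 :=
    fun d => integrable_normSq_windowSum (dyadic N) logFreq (fun m => b m * e ((m : ℝ) * ((d : ℝ) / c))) Ξ δ
  have hint0 : ∀ d : ℕ, IntervalIntegrable (fun ξ : ℝ =>
      ‖∑ m ∈ dyadic N, b m * e ((m : ℝ) * ((d : ℝ) / c)) * e (logFreq m * ξ)‖ ^ 2) volume (-Ξ) Ξ := by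
    intro d
    apply Continuous.intervalIntegrable
    refine (continuous_finsetSum _ fun m _ => ?_).norm.pow 2
    exact continuous_const.mul (continuous_e_coe.comp (continuous_const.mul continuous_id))
  have hstep2 : ∫ ξ in (-Ξ)..Ξ, ∑ d ∈ units c,
        ‖∑ m ∈ dyadic N, b m * e ((m : ℝ) * ((d : ℝ) / c)) * e (logFreq m * ξ)‖ ^ 2 ≤
      π ^ 2 * ∫ x : ℝ, ∑ d ∈ units c,
        ‖(Ξ : ℂ) * ∑ m ∈ (dyadic N).filter (fun m => x ≤ logFreq m ∧ logFreq m ≤ x + δ),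
          b m * e ((m : ℝ) * ((d : ℝ) / c))‖ ^ 2 := by
    rw [intervalIntegral.integral_finsetSum fun d _ => hint0 d,
      integral_finsetSum _ fun d _ => hint d, mul_sum]
    exact sum_le_sum fun d _ => hG d
  -- Step 3: the pointwise bound integrated
  have hRint : Integrable fun x : ℝ => ∑ m ∈ dyadic N, ‖b m‖ ^ 2 * K *
      (Set.Icc (logFreq m - δ) (logFreq m)).indicator (fun _ => (1 : ℝ)) x := by
    refine integrable_finsetSum _ fun m _ => ?_
    refine Integrable.const_mul ?_ _
    rw [integrable_indicator_iff measurableSet_Icc]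
    exact integrableOn_const (by exact measure_Icc_lt_top.ne)
  have hstep3 : ∫ x : ℝ, ∑ d ∈ units c,
        ‖(Ξ : ℂ) * ∑ m ∈ (dyadic N).filter (fun m => x ≤ logFreq m ∧ logFreq m ≤ x + δ),
          b m * e ((m : ℝ) * ((d : ℝ) / c))‖ ^ 2 ≤
      ∫ x : ℝ, ∑ m ∈ dyadic N, ‖b m‖ ^ 2 * K *
        (Set.Icc (logFreq m - δ) (logFreq m)).indicator (fun _ => (1 : ℝ)) x := by
    refine integral_mono (integrable_finsetSum _ fun d _ => hint d) hRint fun x => ?_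
    exact window_bound_farey hc hN b hδ0 x
  -- Step 4: evaluate the right-hand integral
  have hstep4 : ∫ x : ℝ, ∑ m ∈ dyadic N, ‖b m‖ ^ 2 * K *
      (Set.Icc (logFreq m - δ) (logFreq m)).indicator (fun _ => (1 : ℝ)) x =
      ∑ m ∈ dyadic N, ‖b m‖ ^ 2 * K * δ := by
    rw [integral_finsetSum _ fun m _ => ?_]
    · exact sum_congr rfl fun m _ => integral_const_mul_indicator_Icc _ _ hδ0.le
    · refine Integrable.const_mul ?_ _
      rw [integrable_indicator_iff measurableSet_Icc]
      exact integrableOn_const (by exact measure_Icc_lt_top.ne)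
  -- Step 5: the arithmetic `π² K δ ≤ π²(π e^π N + 2cΞ)`
  have hKδ : π ^ 2 * (K * δ) ≤ π ^ 2 * (π * Real.exp π * N + 2 * c * Ξ) := by
    refine mul_le_mul_of_nonneg_left ?_ (by positivity)
    have hTδ : Ξ ^ 2 * δ = Ξ / 2 := by
      rw [hδ]; field_simp
    have hexpδ := exp_window_factor_le hΞ
    rw [← hδ] at hexpδ
    have hc1 : (1 : ℝ) ≤ c := by exact_mod_cast hc
    calc K * δ = (Ξ ^ 2 * δ) * ((Real.exp (2 * π * δ) - 1) * (2 * N) + 2 + 2 * c) := by rw [hK]; ring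
      _ = ((Real.exp (2 * π * δ) - 1) * Ξ) * N + Ξ * (1 + c) := by rw [hTδ]; ring
      _ ≤ π * Real.exp π * N + Ξ * (2 * c) := by
          gcongr
          linarith
      _ = π * Real.exp π * N + 2 * c * Ξ := by ring
  -- assemble
  calc _ ≤ π ^ 2 * ∫ x : ℝ, ∑ d ∈ units c,
        ‖(Ξ : ℂ) * ∑ m ∈ (dyadic N).filter (fun m => x ≤ logFreq m ∧ logFreq m ≤ x + δ),
          b m * e ((m : ℝ) * ((d : ℝ) / c))‖ ^ 2 := hstep2
    _ ≤ π ^ 2 * ∑ m ∈ dyadic N, ‖b m‖ ^ 2 * K * δ := by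
        rw [← hstep4]; exact mul_le_mul_of_nonneg_left hstep3 (by positivity)
    _ = π ^ 2 * (K * δ) * l2 N b := by
        unfold l2; rw [mul_sum, mul_sum]; refine sum_congr rfl fun m _ => ?_; ring
    _ ≤ π ^ 2 * (π * Real.exp π * N + 2 * c * Ξ) * l2 N b :=
        mul_le_mul_of_nonneg_right hKδ (l2_nonneg N b)


/-! ### The Kloosterman sum opened, and the reindexing `d ↦ −d̄` of the reduced residues -/

/-- `e(m/c) = stdAddChar (m mod c)` for integers `m`. [folklore] -/
theorem fourierChar_intCast_div (c : ℕ) [NeZero c] (m : ℤ) :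
    (𝐞 ((m : ℝ) / c) : ℂ) = ZMod.stdAddChar (m : ZMod c) := by
  rw [ZMod.stdAddChar_coe, Real.fourierChar_apply]
  congr 1
  push_cast
  ring

/-- The inverse representative `d̄ ∈ [0, c)` of a reduced residue `d`. [folklore] -/
def inv (c d : ℕ) : ℕ := (((d : ZMod c))⁻¹).val

/-- **The Kloosterman sum as a sum over reduced residues**:
`S(m, n; c) = ∑_{0 ≤ d < c, (d,c)=1} e(m d/c) e(n d̄/c)`. [cite: Iwaniec2002, §2.5 (2.23)] -/
theorem kloo_eq_sum_units (m n : ℤ) {c : ℕ} (hc : 0 < c) :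
    kloo m n c = ∑ d ∈ units c, e ((m : ℝ) * ((d : ℝ) / c)) * e ((n : ℝ) * ((inv c d : ℝ) / c)) := by
  classical
  haveI : NeZero c := ⟨hc.ne'⟩
  rw [kloo_of_neZero]
  unfold kloostermanSum
  rw [sum_zmod_eq_sum_range, ← sum_filter_add_sum_filter_not (range c) (fun x : ℕ => x.Coprime c)]
  have hzero : ∑ x ∈ (range c).filter (fun x : ℕ => ¬ x.Coprime c),
      (if IsUnit ((x : ℕ) : ZMod c) then
        (ZMod.stdAddChar ((m : ZMod c) * ((x : ℕ) : ZMod c) + (n : ZMod c) * (((x : ℕ) : ZMod c))⁻¹) : ℂ)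
       else 0) = 0 := by
    refine sum_eq_zero fun x hx => ?_
    rw [mem_filter] at hx
    rw [if_neg]
    rw [ZMod.isUnit_iff_coprime]
    exact hx.2
  rw [hzero, add_zero]
  refine sum_congr rfl fun x hx => ?_
  have hx' : x ∈ units c := hx
  rw [units, mem_filter] at hx
  rw [if_pos ((ZMod.isUnit_iff_coprime x c).2 hx.2)]
  have h1 : e ((m : ℝ) * ((x : ℝ) / c)) = ZMod.stdAddChar ((m : ZMod c) * ((x : ℕ) : ZMod c)) := by
    rw [show (m : ℝ) * ((x : ℝ) / c) = ((m * x : ℤ) : ℝ) / c by push_cast; ring, e,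
      fourierChar_intCast_div]
    push_cast; rfl
  have h2 : e ((n : ℝ) * ((inv c x : ℝ) / c)) = ZMod.stdAddChar ((n : ZMod c) * (((x : ℕ) : ZMod c))⁻¹) := by
    rw [show (n : ℝ) * ((inv c x : ℝ) / c) = ((n * (inv c x : ℕ) : ℤ) : ℝ) / c by push_cast; ring, e,
      fourierChar_intCast_div]
    congr 1
    push_cast
    rw [inv, ZMod.natCast_zmod_val]
  rw [h1, h2, ← AddChar.map_add_eq_mul]

/-- The map `d ↦ (−d̄) mod c` on representatives. [folklore] -/
def negInv (c d : ℕ) : ℕ := (-(((d : ZMod c))⁻¹)).val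

/-- For a reduced residue `d`, `(d mod c)⁻¹ = ↑(u⁻¹)` with `u` the unit `d`. [folklore] -/
theorem inv_natCast_eq_unit {c d : ℕ} (hd : d.Coprime c) :
    ((d : ZMod c))⁻¹ = ((ZMod.unitOfCoprime d hd)⁻¹ : (ZMod c)ˣ) := by
  rw [← ZMod.coe_unitOfCoprime d hd, ZMod.inv_coe_unit]

/-- `negInv` maps reduced residues to reduced residues. [folklore] -/
theorem negInv_mem_units {c : ℕ} (hc : 0 < c) {d : ℕ} (hd : d ∈ units c) : negInv c d ∈ units c := by
  haveI : NeZero c := ⟨hc.ne'⟩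
  rw [units, mem_filter, mem_range] at hd ⊢
  refine ⟨ZMod.val_lt _, ?_⟩
  rw [← ZMod.isUnit_iff_coprime, negInv, ZMod.natCast_zmod_val, inv_natCast_eq_unit hd.2,
    ← Units.val_neg]
  exact Units.isUnit _

/-- `negInv` is an involution on reduced residues. [folklore] -/
theorem negInv_negInv {c : ℕ} (hc : 0 < c) {d : ℕ} (hd : d ∈ units c) : negInv c (negInv c d) = d := by
  haveI : NeZero c := ⟨hc.ne'⟩
  rw [units, mem_filter, mem_range] at hd
  set u : (ZMod c)ˣ := ZMod.unitOfCoprime d hd.2 with hu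
  have h1 : (((negInv c d : ℕ) : ZMod c)) = ((-u⁻¹ : (ZMod c)ˣ) : ZMod c) := by
    rw [negInv, ZMod.natCast_zmod_val, inv_natCast_eq_unit hd.2, Units.val_neg]
  rw [negInv, h1, ZMod.inv_coe_unit, inv_neg, inv_inv, Units.val_neg, neg_neg, hu,
    ZMod.coe_unitOfCoprime, ZMod.val_natCast, Nat.mod_eq_of_lt hd.1]

/-- As residues, `negInv c d ≡ −d̄`, so `e(n · negInv/c) = e(−n d̄/c)`. [folklore] -/
theorem e_negInv {c : ℕ} (hc : 0 < c) (d : ℕ) (n : ℤ) :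
    e ((n : ℝ) * ((negInv c d : ℝ) / c)) = e (-((n : ℝ) * ((inv c d : ℝ) / c))) := by
  haveI : NeZero c := ⟨hc.ne'⟩
  rw [show (n : ℝ) * ((negInv c d : ℝ) / c) = ((n * (negInv c d : ℕ) : ℤ) : ℝ) / c by push_cast; ring,
    show -((n : ℝ) * ((inv c d : ℝ) / c)) = ((-(n * (inv c d : ℕ)) : ℤ) : ℝ) / c by push_cast; ring,
    e, e, fourierChar_intCast_div, fourierChar_intCast_div]
  congr 1
  push_cast
  rw [negInv, inv, ZMod.natCast_zmod_val, ZMod.natCast_zmod_val]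
  ring

/-- **Reindexing the reduced residues by `d ↦ −d̄`**: `∑*_d F(negInv d) = ∑*_d F(d)`. [folklore] -/
theorem sum_units_negInv {c : ℕ} (hc : 0 < c) (F : ℕ → ℝ) :
    ∑ d ∈ units c, F (negInv c d) = ∑ d ∈ units c, F d :=
  sum_nbij' (negInv c) (negInv c) (fun _ hd => negInv_mem_units hc hd)
    (fun _ hd => negInv_mem_units hc hd) (fun _ hd => negInv_negInv hc hd)
    (fun _ hd => negInv_negInv hc hd) (fun _ _ => rfl)

/-! ### The weight `G(u) = ρ(u) e(κ e^{u/2})` and its Fourier transform -/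

/-- A fixed smooth plateau `ρ` on the logarithmic scale: `ρ = 1` on `[log 2 − 1, log 2 + 1] ⊇ [0, log 4]`,
`0 ≤ ρ ≤ 1`, supported in `(log 2 − 2, log 2 + 2)`. [folklore] -/
def rho : ContDiffBump (Real.log 2) := ⟨1, 2, zero_lt_one, one_lt_two⟩

/-- The phase `E_κ(u) = e(κ e^{u/2}) = exp(2πi κ e^{u/2})`. [folklore] -/
def phaseE (κ u : ℝ) : ℂ := Complex.exp ((2 * π * κ * I) * (Real.exp (u / 2) : ℂ))

/-- `E_κ(u) = e(κ e^{u/2})` as the additive character. [folklore] -/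
theorem phaseE_eq_e (κ u : ℝ) : phaseE κ u = e (κ * Real.exp (u / 2)) := by
  rw [phaseE, e_eq_exp]
  congr 1
  push_cast
  ring

/-- `|E_κ(u)| = 1`. [folklore] -/
theorem norm_phaseE (κ u : ℝ) : ‖phaseE κ u‖ = 1 := by
  rw [phaseE_eq_e, norm_e]

/-- The weight `G_κ(u) = ρ(u) e(κ e^{u/2})`. [folklore] -/
def G (κ u : ℝ) : ℂ := ((rho u : ℝ) : ℂ) * phaseE κ u

/-- `|G_κ(u)| ≤ 1`. [folklore] -/
theorem norm_G_le (κ u : ℝ) : ‖G κ u‖ ≤ 1 := by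
  rw [G, norm_mul, norm_phaseE, mul_one, Complex.norm_real, Real.norm_eq_abs,
    abs_of_nonneg (rho.nonneg)]
  exact rho.le_one

/-- `G_κ(u) = e(κ e^{u/2})` where the plateau is `1`: `|u − log 2| ≤ 1`. [folklore] -/
theorem G_eq_of_abs_le {κ u : ℝ} (hu : |u - Real.log 2| ≤ 1) : G κ u = e (κ * Real.exp (u / 2)) := by
  rw [G, ← phaseE_eq_e]
  have : (rho : ℝ → ℝ) u = 1 := rho.one_of_mem_closedBall (by
    rw [Metric.mem_closedBall, Real.dist_eq]; exact hu)
  rw [this]; push_cast; ring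

/-- `G_κ(u) = 0` off `(log 2 − 2, log 2 + 2)`. [folklore] -/
theorem G_eq_zero_of_le {κ u : ℝ} (hu : 2 ≤ |u - Real.log 2|) : G κ u = 0 := by
  rw [G]
  have : (rho : ℝ → ℝ) u = 0 := rho.zero_of_le_dist (by rw [Real.dist_eq]; exact hu)
  rw [this]; push_cast; ring

/-- `G_κ` is smooth. [folklore] -/
theorem contDiff_G (κ : ℝ) : ContDiff ℝ ∞ (G κ) := by
  unfold G phaseE
  refine ContDiff.mul (Complex.ofRealCLM.contDiff.comp rho.contDiff) ?_
  refine Complex.contDiff_exp.comp (contDiff_const.mul ?_)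
  exact Complex.ofRealCLM.contDiff.comp (Real.contDiff_exp.comp (contDiff_id.div_const _))

/-- `G_κ` has compact support. [folklore] -/
theorem hasCompactSupport_G (κ : ℝ) : HasCompactSupport (G κ) := by
  unfold G
  refine HasCompactSupport.mul_right ?_
  exact rho.hasCompactSupport.comp_left Complex.ofReal_zero

/-- The iterated derivatives of `G_κ` have compact support. [folklore] -/
theorem hasCompactSupport_iteratedDeriv_G (κ : ℝ) (n : ℕ) : HasCompactSupport (iteratedDeriv n (G κ)) := by
  induction n with
  | zero => simpa using hasCompactSupport_G κ
  | succ n ih => rw [iteratedDeriv_succ]; exact ih.deriv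

/-- `G_κ` vanishes outside `[log 2 − 2, log 2 + 2]`. [folklore] -/
theorem G_eq_zero_of_not_mem {κ u : ℝ} (hu : u ∉ Set.Icc (Real.log 2 - 2) (Real.log 2 + 2)) : G κ u = 0 := by
  apply G_eq_zero_of_le
  rw [Set.mem_Icc, not_and_or, not_le, not_le] at hu
  rcases hu with h | h
  · rw [abs_of_neg (by linarith)]; linarith
  · rw [abs_of_pos (by linarith)]; linarith

/-- `∫ |G_κ| ≤ 4`. [folklore] -/
theorem integral_norm_G_le (κ : ℝ) : ∫ u, ‖G κ u‖ ≤ 4 := by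
  have hsupp : ∀ u, ‖G κ u‖ = (Set.Icc (Real.log 2 - 2) (Real.log 2 + 2)).indicator (fun u => ‖G κ u‖) u := by
    intro u
    by_cases hu : u ∈ Set.Icc (Real.log 2 - 2) (Real.log 2 + 2)
    · rw [Set.indicator_of_mem hu]
    · rw [Set.indicator_of_notMem hu, G_eq_zero_of_not_mem hu, norm_zero]
  calc ∫ u, ‖G κ u‖ = ∫ u, (Set.Icc (Real.log 2 - 2) (Real.log 2 + 2)).indicator (fun u => ‖G κ u‖) u :=
        integral_congr_ae (Filter.Eventually.of_forall hsupp)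
    _ = ∫ u in Set.Icc (Real.log 2 - 2) (Real.log 2 + 2), ‖G κ u‖ := integral_indicator measurableSet_Icc
    _ ≤ ∫ u in Set.Icc (Real.log 2 - 2) (Real.log 2 + 2), (1 : ℝ) := by
        refine setIntegral_mono_on ?_ (integrableOn_const (by exact measure_Icc_lt_top.ne))
          measurableSet_Icc fun u _ => norm_G_le κ u
        exact ((contDiff_G κ).continuous.norm.integrable_of_hasCompactSupport
          (hasCompactSupport_G κ).norm).integrableOn
    _ = 4 := by
        rw [setIntegral_const, smul_eq_mul, mul_one, Measure.real, Real.volume_Icc,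
          ENNReal.toReal_ofReal (by linarith)]
        ring

/-! #### The second derivative of `G_κ` -/

/-- `L₁(u) = π i κ e^{u/2}`, the derivative of the exponent `2π i κ e^{u/2}`. [folklore] -/
def L₁ (κ u : ℝ) : ℂ := (π * κ * I) * (Real.exp (u / 2) : ℂ)

/-- `(e^{u/2})' = e^{u/2}/2` through the coercion to `ℂ`. [folklore] -/
theorem hasDerivAt_exp_half (u : ℝ) :
    HasDerivAt (fun u : ℝ => (Real.exp (u / 2) : ℂ)) ((Real.exp (u / 2) : ℂ) / 2) u := by
  have h1 : HasDerivAt (fun u : ℝ => Real.exp (u / 2)) (Real.exp (u / 2) * (1 / 2)) u :=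
    (Real.hasDerivAt_exp _).comp u ((hasDerivAt_id u).div_const 2)
  have h2 := h1.ofReal_comp
  convert h2 using 1
  push_cast; ring

/-- `E_κ' = E_κ L₁`. [folklore] -/
theorem hasDerivAt_phaseE (κ u : ℝ) : HasDerivAt (phaseE κ) (phaseE κ u * L₁ κ u) u :=
  (((hasDerivAt_exp_half u).const_mul (2 * π * κ * I)).cexp).congr_deriv (by rw [phaseE, L₁]; ring)

/-- `L₁' = L₁/2`. [folklore] -/
theorem hasDerivAt_L₁ (κ u : ℝ) : HasDerivAt (L₁ κ) (L₁ κ u / 2) u :=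
  ((hasDerivAt_exp_half u).const_mul (π * κ * I)).congr_deriv (by rw [L₁]; ring)

/-- The real plateau through the coercion: `(ρ)' = ρ'`. [folklore] -/
theorem hasDerivAt_rho_ofReal (u : ℝ) :
    HasDerivAt (fun u : ℝ => (((rho : ℝ → ℝ) u : ℝ) : ℂ)) ((deriv (rho : ℝ → ℝ) u : ℝ) : ℂ) u :=
  ((rho.contDiff (n := 1)).differentiable (by simp) u).hasDerivAt.ofReal_comp

/-- `(ρ')' = ρ''` through the coercion. [folklore] -/
theorem hasDerivAt_deriv_rho_ofReal (u : ℝ) :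
    HasDerivAt (fun u : ℝ => ((deriv (rho : ℝ → ℝ) u : ℝ) : ℂ))
      ((iteratedDeriv 2 (rho : ℝ → ℝ) u : ℝ) : ℂ) u := by
  have hd : Differentiable ℝ (deriv (rho : ℝ → ℝ)) := by
    rw [← iteratedDeriv_one]
    exact (rho.contDiff (n := 2)).differentiable_iteratedDeriv 1 (by norm_cast)
  have h := (hd u).hasDerivAt.ofReal_comp
  rw [iteratedDeriv_succ, iteratedDeriv_one]
  exact h

/-- `G_κ' = E_κ (ρ' + ρ L₁)`. [folklore] -/
theorem hasDerivAt_G (κ u : ℝ) :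
    HasDerivAt (G κ) (phaseE κ u * (((deriv (rho : ℝ → ℝ) u : ℝ) : ℂ) + ((rho u : ℝ) : ℂ) * L₁ κ u)) u := by
  have h := (hasDerivAt_rho_ofReal u).mul (hasDerivAt_phaseE κ u)
  refine (h.congr_deriv (by ring)).congr_of_eventuallyEq (Filter.Eventually.of_forall fun v => ?_)
  rfl

/-- The first derivative of `G_κ` as a function. [folklore] -/
def G₁ (κ u : ℝ) : ℂ := phaseE κ u * (((deriv (rho : ℝ → ℝ) u : ℝ) : ℂ) + ((rho u : ℝ) : ℂ) * L₁ κ u)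

/-- `deriv G_κ = G₁`. [folklore] -/
theorem deriv_G (κ : ℝ) : deriv (G κ) = G₁ κ := funext fun u => (hasDerivAt_G κ u).deriv

/-- The second derivative of `G_κ` as a function: `E (ρ'' + 2ρ'L₁ + ρ(L₁² + L₁/2))`. [folklore] -/
def G₂ (κ u : ℝ) : ℂ :=
  phaseE κ u * (((iteratedDeriv 2 (rho : ℝ → ℝ) u : ℝ) : ℂ) + 2 * ((deriv (rho : ℝ → ℝ) u : ℝ) : ℂ) * L₁ κ u +
    ((rho u : ℝ) : ℂ) * (L₁ κ u ^ 2 + L₁ κ u / 2))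

/-- `G₁' = G₂`. [folklore] -/
theorem hasDerivAt_G₁ (κ u : ℝ) : HasDerivAt (G₁ κ) (G₂ κ u) u := by
  unfold G₁ G₂
  have hE := hasDerivAt_phaseE κ u
  have hin : HasDerivAt (fun u => ((deriv (rho : ℝ → ℝ) u : ℝ) : ℂ) + ((rho u : ℝ) : ℂ) * L₁ κ u)
      (((iteratedDeriv 2 (rho : ℝ → ℝ) u : ℝ) : ℂ) +
        (((deriv (rho : ℝ → ℝ) u : ℝ) : ℂ) * L₁ κ u + ((rho u : ℝ) : ℂ) * (L₁ κ u / 2))) u :=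
    (hasDerivAt_deriv_rho_ofReal u).add ((hasDerivAt_rho_ofReal u).mul (hasDerivAt_L₁ κ u))
  have h := hE.mul hin
  refine (h.congr_deriv (by ring)).congr_of_eventuallyEq (Filter.Eventually.of_forall fun v => ?_)
  rfl

/-- `iteratedDeriv 2 G_κ = G₂`. [folklore] -/
theorem iteratedDeriv_two_G (κ : ℝ) : iteratedDeriv 2 (G κ) = G₂ κ := by
  rw [iteratedDeriv_succ, iteratedDeriv_one, deriv_G]
  exact funext fun u => (hasDerivAt_G₁ κ u).deriv


/-! #### Size of `G''` and of the Fourier transform `𝓕 G_κ` -/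

/-- A common bound `M` for `|ρ'|` and `|ρ''|` (they are continuous with compact support). [folklore] -/
theorem exists_rho_deriv_bound :
    ∃ M : ℝ, 0 ≤ M ∧ (∀ u, |deriv (rho : ℝ → ℝ) u| ≤ M) ∧ (∀ u, |iteratedDeriv 2 (rho : ℝ → ℝ) u| ≤ M) := by
  obtain ⟨M₁, hM₁⟩ := ((rho.contDiff (n := 1)).continuous_deriv le_rfl).bounded_above_of_compact_support
    rho.hasCompactSupport.deriv
  obtain ⟨M₂, hM₂⟩ := ((rho.contDiff (n := 2)).continuous_iteratedDeriv 2 le_rfl).bounded_above_of_compact_support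
    (by rw [iteratedDeriv_succ, iteratedDeriv_one]; exact rho.hasCompactSupport.deriv.deriv)
  refine ⟨max (max M₁ M₂) 0, le_max_right _ _, fun u => ?_, fun u => ?_⟩
  · exact (Real.norm_eq_abs _ ▸ hM₁ u).trans ((le_max_left _ _).trans (le_max_left _ _))
  · exact (Real.norm_eq_abs _ ▸ hM₂ u).trans ((le_max_right _ _).trans (le_max_left _ _))

/-- The constant `β = π e²` with `|L₁| ≤ β|κ|` on the support of `ρ`. [folklore] -/
def betaL : ℝ := π * Real.exp 2

/-- `|L₁(u)| ≤ π e² |κ|` for `u ≤ log 2 + 2`. [folklore] -/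
theorem norm_L₁_le {κ u : ℝ} (hu : u ≤ Real.log 2 + 2) : ‖L₁ κ u‖ ≤ betaL * |κ| := by
  rw [L₁, norm_mul, Complex.norm_real, Real.norm_eq_abs, abs_of_pos (Real.exp_pos _)]
  have h1 : ‖(π * κ * I : ℂ)‖ = π * |κ| := by
    rw [norm_mul, norm_mul, Complex.norm_I, mul_one, Complex.norm_real, Complex.norm_real,
      Real.norm_eq_abs, Real.norm_eq_abs, abs_of_pos Real.pi_pos]
  rw [h1, betaL]
  have hlog : Real.log 2 ≤ 2 := by
    have := Real.log_le_sub_one_of_pos (by norm_num : (0:ℝ) < 2); linarith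
  have hexp : Real.exp (u / 2) ≤ Real.exp 2 := Real.exp_le_exp.2 (by linarith)
  calc π * |κ| * Real.exp (u / 2) ≤ π * |κ| * Real.exp 2 := by gcongr
    _ = π * Real.exp 2 * |κ| := by ring

/-- **Pointwise bound for `G''`**: with `M` from `exists_rho_deriv_bound`,
`‖G₂(u)‖ ≤ (M + 2Mβ + β² + β) (1 + |κ|)²` for `u ≤ log 2 + 2`. [folklore] -/
theorem norm_G₂_le {M : ℝ} (hM0 : 0 ≤ M) (hM1 : ∀ u, |deriv (rho : ℝ → ℝ) u| ≤ M)
    (hM2 : ∀ u, |iteratedDeriv 2 (rho : ℝ → ℝ) u| ≤ M) {κ u : ℝ} (hu : u ≤ Real.log 2 + 2) :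
    ‖G₂ κ u‖ ≤ (M + 2 * M * betaL + betaL ^ 2 + betaL) * (1 + |κ|) ^ 2 := by
  have hβ : 0 ≤ betaL := by unfold betaL; positivity
  have hL := norm_L₁_le (κ := κ) hu
  have hρ : ‖((rho u : ℝ) : ℂ)‖ ≤ 1 := by
    rw [Complex.norm_real, Real.norm_eq_abs, abs_of_nonneg rho.nonneg]; exact rho.le_one
  have hρ1 : ‖((deriv (rho : ℝ → ℝ) u : ℝ) : ℂ)‖ ≤ M := by
    rw [Complex.norm_real, Real.norm_eq_abs]; exact hM1 u
  have hρ2 : ‖((iteratedDeriv 2 (rho : ℝ → ℝ) u : ℝ) : ℂ)‖ ≤ M := by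
    rw [Complex.norm_real, Real.norm_eq_abs]; exact hM2 u
  have hk : |κ| ≤ (1 + |κ|) ^ 2 := by nlinarith [abs_nonneg κ]
  have hk2 : |κ| ^ 2 ≤ (1 + |κ|) ^ 2 := by nlinarith [abs_nonneg κ]
  have h1 : (1 : ℝ) ≤ (1 + |κ|) ^ 2 := by nlinarith [abs_nonneg κ]
  unfold G₂
  rw [norm_mul, norm_phaseE, one_mul]
  calc ‖((iteratedDeriv 2 (rho : ℝ → ℝ) u : ℝ) : ℂ) + 2 * ((deriv (rho : ℝ → ℝ) u : ℝ) : ℂ) * L₁ κ u +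
        ((rho u : ℝ) : ℂ) * (L₁ κ u ^ 2 + L₁ κ u / 2)‖
      ≤ ‖((iteratedDeriv 2 (rho : ℝ → ℝ) u : ℝ) : ℂ)‖ + ‖2 * ((deriv (rho : ℝ → ℝ) u : ℝ) : ℂ) * L₁ κ u‖ +
        ‖((rho u : ℝ) : ℂ) * (L₁ κ u ^ 2 + L₁ κ u / 2)‖ := norm_add₃_le
    _ ≤ M + 2 * M * (betaL * |κ|) + 1 * ((betaL * |κ|) ^ 2 + betaL * |κ| / 2) := by
        gcongr
        · rw [norm_mul, norm_mul, Complex.norm_ofNat]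
          gcongr
        · rw [norm_mul]
          gcongr
          refine (norm_add_le _ _).trans ?_
          rw [norm_pow, norm_div, Complex.norm_ofNat]
          gcongr
    _ ≤ (M + 2 * M * betaL + betaL ^ 2 + betaL) * (1 + |κ|) ^ 2 := by
        have e1 : M ≤ M * (1 + |κ|) ^ 2 := by nlinarith
        have e2 : 2 * M * (betaL * |κ|) ≤ 2 * M * betaL * (1 + |κ|) ^ 2 := by nlinarith [mul_nonneg hM0 hβ]
        have e3 : (betaL * |κ|) ^ 2 ≤ betaL ^ 2 * (1 + |κ|) ^ 2 := by
          rw [mul_pow]; exact mul_le_mul_of_nonneg_left hk2 (by positivity)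
        have e4 : betaL * |κ| / 2 ≤ betaL * (1 + |κ|) ^ 2 := by nlinarith [mul_nonneg hβ (abs_nonneg κ)]
        nlinarith

/-- `G₂ = G''` vanishes outside `[log 2 − 2, log 2 + 2]`. [folklore] -/
theorem G₂_eq_zero_of_not_mem {κ u : ℝ} (hu : u ∉ Set.Icc (Real.log 2 - 2) (Real.log 2 + 2)) : G₂ κ u = 0 := by
  rw [← iteratedDeriv_two_G]
  have hopen : IsOpen (Set.Icc (Real.log 2 - 2) (Real.log 2 + 2))ᶜ := isClosed_Icc.isOpen_compl
  have hEq : Set.EqOn (G κ) (fun _ => (0 : ℂ)) (Set.Icc (Real.log 2 - 2) (Real.log 2 + 2))ᶜ :=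
    fun v hv => G_eq_zero_of_not_mem hv
  rw [hEq.iteratedDeriv_of_isOpen hopen 2 hu, iteratedDeriv_const]
  simp

/-- `G_κ` is integrable, and so are all its derivatives. [folklore] -/
theorem integrable_iteratedDeriv_G (κ : ℝ) (n : ℕ) : Integrable (iteratedDeriv n (G κ)) :=
  ((contDiff_G κ).continuous_iteratedDeriv n (by exact_mod_cast le_top)).integrable_of_hasCompactSupport
    (hasCompactSupport_iteratedDeriv_G κ n)

/-- `G_κ` is integrable. [folklore] -/
theorem integrable_G (κ : ℝ) : Integrable (G κ) :=
  (contDiff_G κ).continuous.integrable_of_hasCompactSupport (hasCompactSupport_G κ)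

/-- **`∫ |G''| ≤ 4 (M + 2Mβ + β² + β)(1 + |κ|)²`.** [folklore] -/
theorem integral_norm_G₂_le {M : ℝ} (hM0 : 0 ≤ M) (hM1 : ∀ u, |deriv (rho : ℝ → ℝ) u| ≤ M)
    (hM2 : ∀ u, |iteratedDeriv 2 (rho : ℝ → ℝ) u| ≤ M) (κ : ℝ) :
    ∫ u, ‖iteratedDeriv 2 (G κ) u‖ ≤ 4 * ((M + 2 * M * betaL + betaL ^ 2 + betaL) * (1 + |κ|) ^ 2) := by
  rw [iteratedDeriv_two_G]
  set C : ℝ := (M + 2 * M * betaL + betaL ^ 2 + betaL) * (1 + |κ|) ^ 2 with hC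
  have hsupp : ∀ u, ‖G₂ κ u‖ = (Set.Icc (Real.log 2 - 2) (Real.log 2 + 2)).indicator (fun u => ‖G₂ κ u‖) u := by
    intro u
    by_cases hu : u ∈ Set.Icc (Real.log 2 - 2) (Real.log 2 + 2)
    · rw [Set.indicator_of_mem hu]
    · rw [Set.indicator_of_notMem hu, G₂_eq_zero_of_not_mem hu, norm_zero]
  have hint : Integrable (fun u => ‖G₂ κ u‖) := by
    rw [← iteratedDeriv_two_G]
    exact (integrable_iteratedDeriv_G κ 2).norm
  calc ∫ u, ‖G₂ κ u‖ = ∫ u, (Set.Icc (Real.log 2 - 2) (Real.log 2 + 2)).indicator (fun u => ‖G₂ κ u‖) u :=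
        integral_congr_ae (Filter.Eventually.of_forall hsupp)
    _ = ∫ u in Set.Icc (Real.log 2 - 2) (Real.log 2 + 2), ‖G₂ κ u‖ := integral_indicator measurableSet_Icc
    _ ≤ ∫ u in Set.Icc (Real.log 2 - 2) (Real.log 2 + 2), C := by
        refine setIntegral_mono_on hint.integrableOn (integrableOn_const (by exact measure_Icc_lt_top.ne))
          measurableSet_Icc fun u hu => ?_
        rw [hC]; exact norm_G₂_le hM0 hM1 hM2 hu.2
    _ = 4 * C := by
        rw [setIntegral_const, smul_eq_mul, Measure.real, Real.volume_Icc,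
          ENNReal.toReal_ofReal (by linarith)]
        ring

/-- **`|𝓕G_κ(ξ)| ≤ 4`.** [folklore] -/
theorem norm_fourier_G_le (κ ξ : ℝ) : ‖𝓕 (G κ) ξ‖ ≤ 4 :=
  (Literature.Analysis.Fourier.norm_fourier_le_integral_norm _ ξ).trans (integral_norm_G_le κ)

/-- **`(2π|ξ|)² |𝓕G_κ(ξ)| ≤ ∫|G''|`.** [folklore] -/
theorem sq_mul_norm_fourier_G_le {M : ℝ} (hM0 : 0 ≤ M) (hM1 : ∀ u, |deriv (rho : ℝ → ℝ) u| ≤ M)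
    (hM2 : ∀ u, |iteratedDeriv 2 (rho : ℝ → ℝ) u| ≤ M) (κ ξ : ℝ) :
    (2 * π * |ξ|) ^ 2 * ‖𝓕 (G κ) ξ‖ ≤ 4 * ((M + 2 * M * betaL + betaL ^ 2 + betaL) * (1 + |κ|) ^ 2) :=
  (Literature.Analysis.Fourier.pow_mul_norm_fourier_le (contDiff_G κ) (integrable_iteratedDeriv_G κ) 2 ξ).trans
    (integral_norm_G₂_le hM0 hM1 hM2 κ)

/-- **The combined bound `|𝓕G_κ(ξ)| ≤ D_κ/(1 + ξ²)`**, `D_κ = 4 + (M + 2Mβ + β² + β)(1+|κ|)²/π²`. [folklore] -/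
theorem norm_fourier_G_le_div {M : ℝ} (hM0 : 0 ≤ M) (hM1 : ∀ u, |deriv (rho : ℝ → ℝ) u| ≤ M)
    (hM2 : ∀ u, |iteratedDeriv 2 (rho : ℝ → ℝ) u| ≤ M) (κ ξ : ℝ) :
    ‖𝓕 (G κ) ξ‖ ≤ (4 + (M + 2 * M * betaL + betaL ^ 2 + betaL) * (1 + |κ|) ^ 2 / π ^ 2) / (1 + ξ ^ 2) := by
  set C : ℝ := (M + 2 * M * betaL + betaL ^ 2 + betaL) * (1 + |κ|) ^ 2 with hC
  have h1 := norm_fourier_G_le κ ξ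
  have h2 := sq_mul_norm_fourier_G_le hM0 hM1 hM2 κ ξ
  rw [← hC] at h2
  have hπ : 0 < π ^ 2 := by positivity
  have h3 : ξ ^ 2 * ‖𝓕 (G κ) ξ‖ ≤ C / π ^ 2 := by
    rw [le_div_iff₀ hπ]
    have : (2 * π * |ξ|) ^ 2 = 4 * π ^ 2 * ξ ^ 2 := by rw [mul_pow, mul_pow, sq_abs]; ring
    nlinarith [norm_nonneg (𝓕 (G κ) ξ)]
  rw [le_div_iff₀ (by positivity)]
  nlinarith

/-- `𝓕G_κ` is continuous. [folklore] -/
theorem continuous_fourier_G (κ : ℝ) : Continuous (𝓕 (G κ)) :=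
  VectorFourier.fourierIntegral_continuous Real.continuous_fourierChar (by exact continuous_inner)
    (integrable_G κ)

/-- **`𝓕G_κ` is integrable** (continuous and `≪ (1 + ξ²)⁻¹`). [folklore] -/
theorem integrable_fourier_G (κ : ℝ) : Integrable (𝓕 (G κ)) := by
  obtain ⟨M, hM0, hM1, hM2⟩ := exists_rho_deriv_bound
  set D : ℝ := 4 + (M + 2 * M * betaL + betaL ^ 2 + betaL) * (1 + |κ|) ^ 2 / π ^ 2
  refine Integrable.mono' (integrable_inv_one_add_sq.const_mul D)
    (continuous_fourier_G κ).aestronglyMeasurable (Filter.Eventually.of_forall fun ξ => ?_)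
  rw [← div_eq_mul_inv]
  exact norm_fourier_G_le_div hM0 hM1 hM2 κ ξ

/-- **Fourier inversion for `G_κ`**: `G_κ(u) = ∫ e(uξ) 𝓕G_κ(ξ) dξ`. [folklore] -/
theorem G_eq_integral_fourier (κ u : ℝ) : G κ u = ∫ ξ, (𝐞 (u * ξ) : ℂ) * 𝓕 (G κ) ξ := by
  have h := (contDiff_G κ).continuous.fourierInv_fourier_eq (integrable_G κ) (integrable_fourier_G κ)
  have hu := congrFun h u
  rw [← hu, Real.fourierInv_eq]
  refine integral_congr_ae (Filter.Eventually.of_forall fun ξ => ?_)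
  simp only [RCLike.inner_apply, conj_trivial, Circle.smul_def, smul_eq_mul]


/-! ### Separation of variables in `e(2θ√(mn)/c)` -/

/-- `log 2 ≤ 1`. [folklore] -/
private theorem log_two_le_one : Real.log 2 ≤ 1 := by
  have := Real.log_two_lt_d9; norm_num at this; linarith

/-- For `m, n ∼ N` the logarithmic variable `u = log m + log n − 2 log N` satisfies `|u − log 2| ≤ 1`
(indeed `0 < u ≤ log 4`). [folklore] -/
theorem abs_logVar_sub_le {N : ℝ} (hN : 0 ≤ N) {m n : ℕ} (hm : m ∈ dyadic N) (hn : n ∈ dyadic N) :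
    |Real.log m + Real.log n - 2 * Real.log N - Real.log 2| ≤ 1 := by
  obtain ⟨hm1, hm2⟩ := (mem_dyadic hN).1 hm
  obtain ⟨hn1, hn2⟩ := (mem_dyadic hN).1 hn
  have hN0 : 0 < N := by
    rcases hN.eq_or_lt with h | h
    · have : (0 : ℝ) < m := by rw [← h] at hm1; exact hm1
      have hm0 : (1 : ℝ) ≤ m := by exact_mod_cast Nat.one_le_iff_ne_zero.2 (by rintro rfl; simp at this)
      rw [← h] at hm2; linarith
    · exact h
  have hm0 : (0 : ℝ) < m := hN0.trans hm1
  have hn0 : (0 : ℝ) < n := hN0.trans hn1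
  -- `log m − log N ∈ (0, log 2]`, same for `n`
  have hm' : 0 < Real.log m - Real.log N ∧ Real.log m - Real.log N ≤ Real.log 2 := by
    rw [← Real.log_div hm0.ne' hN0.ne']
    constructor
    · exact Real.log_pos ((one_lt_div hN0).2 hm1)
    · exact Real.log_le_log (div_pos hm0 hN0) ((div_le_iff₀ hN0).2 (by linarith))
  have hn' : 0 < Real.log n - Real.log N ∧ Real.log n - Real.log N ≤ Real.log 2 := by
    rw [← Real.log_div hn0.ne' hN0.ne']
    constructor
    · exact Real.log_pos ((one_lt_div hN0).2 hn1)
    · exact Real.log_le_log (div_pos hn0 hN0) ((div_le_iff₀ hN0).2 (by linarith))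
  have hl2 : 0 < Real.log 2 := Real.log_pos one_lt_two
  rw [abs_le]
  constructor <;> nlinarith [log_two_le_one]

/-- `e^{u/2} = √m √n / N` for the logarithmic variable. [folklore] -/
theorem exp_logVar_half {N : ℝ} (hN : 0 < N) {m n : ℕ} (hm : 0 < m) (hn : 0 < n) :
    Real.exp ((Real.log m + Real.log n - 2 * Real.log N) / 2) = Real.sqrt m * Real.sqrt n / N := by
  have hm0 : (0 : ℝ) < m := by exact_mod_cast hm
  have hn0 : (0 : ℝ) < n := by exact_mod_cast hn
  rw [show (Real.log m + Real.log n - 2 * Real.log N) / 2 = Real.log m / 2 + Real.log n / 2 - Real.log N by ring,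
    Real.exp_sub, Real.exp_add, Real.exp_log hN]
  congr 1
  rw [Real.sqrt_eq_rpow, Real.sqrt_eq_rpow, Real.rpow_def_of_pos hm0, Real.rpow_def_of_pos hn0]
  congr 1 <;> congr 1 <;> ring

/-- **The phase is a value of `G`**: for `m, n ∼ N` (`N > 0`, `c ≥ 1`),
`e(2θ√(mn)/c) = G_κ(log m + log n − 2 log N)` with `κ = 2θN/c`. [folklore] -/
theorem phase_eq_G {θ N : ℝ} (hN : 0 < N) {c : ℕ} (hc : 1 ≤ c) {m n : ℕ} (hm : m ∈ dyadic N)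
    (hn : n ∈ dyadic N) :
    e (2 * θ * Real.sqrt ((m : ℝ) * n) / c) =
      G (2 * θ * N / c) (Real.log m + Real.log n - 2 * Real.log N) := by
  have hm0 := pos_of_mem_dyadic hN.le hm
  have hn0 := pos_of_mem_dyadic hN.le hn
  rw [G_eq_of_abs_le (abs_logVar_sub_le hN.le hm hn), exp_logVar_half hN hm0 hn0]
  congr 1
  have hc0 : (0 : ℝ) < c := by exact_mod_cast hc
  rw [Real.sqrt_mul (Nat.cast_nonneg m)]
  field_simp

/-- The character of the logarithmic variable splits:
`e(u ξ) = e(ν_m · 2πξ) e(ν_n · 2πξ) e(−2ξ log N)`, `ν_m = (log m)/2π`. [folklore] -/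
theorem fourierChar_logVar_mul (m n : ℕ) (N ξ : ℝ) :
    e ((Real.log m + Real.log n - 2 * Real.log N) * ξ) =
      e (logFreq m * (2 * π * ξ)) * e (logFreq n * (2 * π * ξ)) * e (-(2 * ξ * Real.log N)) := by
  rw [← e_add, ← e_add]
  congr 1
  rw [logFreq, logFreq]
  field_simp
  ring

/-- The `m`-sum at the point `d/c`: `P(ξ, d) = ∑_{m∼N} b_m e(md/c) e(ν_m · 2πξ)`. [folklore] -/
def Psum (c : ℕ) (N : ℝ) (b : ℕ → ℂ) (ξ : ℝ) (d : ℕ) : ℂ :=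
  ∑ m ∈ dyadic N, b m * e ((m : ℝ) * ((d : ℝ) / c)) * e (logFreq m * (2 * π * ξ))

/-- `∑*_d |P(ξ, d)|²`. [folklore] -/
def Ssum (c : ℕ) (N : ℝ) (b : ℕ → ℂ) (ξ : ℝ) : ℝ := ∑ d ∈ units c, ‖Psum c N b ξ d‖ ^ 2

/-- `Ssum ≥ 0`. [folklore] -/
theorem Ssum_nonneg (c : ℕ) (N : ℝ) (b : ℕ → ℂ) (ξ : ℝ) : 0 ≤ Ssum c N b ξ :=
  sum_nonneg fun _ _ => by positivity

/-- `Ssum` is continuous in `ξ`. [folklore] -/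
theorem continuous_Ssum (c : ℕ) (N : ℝ) (b : ℕ → ℂ) : Continuous (Ssum c N b) := by
  unfold Ssum Psum
  refine continuous_finsetSum _ fun d _ => (Continuous.norm ?_).pow 2
  refine continuous_finsetSum _ fun m _ => ?_
  exact continuous_const.mul (continuous_e_coe.comp (continuous_const.mul (continuous_const.mul continuous_id)))

/-- The `(m, n)`-sum against the character: `T(ξ) = ∑_{m,n} b_m b̄_n S(m,n;c) e(u_{mn} ξ)`. [folklore] -/
def Tsum (c : ℕ) (N : ℝ) (b : ℕ → ℂ) (ξ : ℝ) : ℂ :=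
  ∑ m ∈ dyadic N, ∑ n ∈ dyadic N,
    b m * conj (b n) * kloo m n c * e ((Real.log m + Real.log n - 2 * Real.log N) * ξ)

/-- **`quadB` as an integral against `𝓕G_κ`** (Fourier inversion of `G_κ` inside the finite sum):
`B(θ, c, N) = ∫ 𝓕G_κ(ξ) T(ξ) dξ`, `κ = 2θN/c`. [folklore] -/
theorem quadB_eq_integral {θ N : ℝ} (hN : 0 < N) {c : ℕ} (hc : 1 ≤ c) (b : ℕ → ℂ) :
    quadB θ c N b = ∫ ξ, 𝓕 (G (2 * θ * N / c)) ξ * Tsum c N b ξ := by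
  set κ : ℝ := 2 * θ * N / c with hκ
  have hint : ∀ m n : ℕ, Integrable fun ξ : ℝ =>
      𝓕 (G κ) ξ * (b m * conj (b n) * kloo m n c *
        e ((Real.log m + Real.log n - 2 * Real.log N) * ξ)) := by
    intro m n
    have hbdd : ∀ᵐ ξ : ℝ ∂volume, ‖b m * conj (b n) * kloo m n c *
        e ((Real.log m + Real.log n - 2 * Real.log N) * ξ)‖ ≤ ‖b m * conj (b n) * kloo m n c‖ :=
      Filter.Eventually.of_forall fun ξ => by rw [norm_mul, Circle.norm_coe, mul_one]
    exact (integrable_fourier_G κ).mul_bdd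
      (continuous_const.mul (continuous_e_coe.comp (continuous_const.mul continuous_id))).aestronglyMeasurable
      hbdd
  have hR : ∫ ξ, 𝓕 (G κ) ξ * Tsum c N b ξ = ∑ m ∈ dyadic N, ∑ n ∈ dyadic N,
      ∫ ξ, 𝓕 (G κ) ξ * (b m * conj (b n) * kloo m n c *
        e ((Real.log m + Real.log n - 2 * Real.log N) * ξ)) := by
    unfold Tsum
    simp_rw [mul_sum]
    rw [integral_finsetSum _ fun m _ => integrable_finsetSum _ fun n _ => hint m n]
    exact sum_congr rfl fun m _ => integral_finsetSum _ fun n _ => hint m n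
  rw [hR]
  unfold quadB
  refine sum_congr rfl fun m hm => sum_congr rfl fun n hn => ?_
  rw [phase_eq_G hN hc hm hn, G_eq_integral_fourier, ← integral_const_mul]
  exact integral_congr_ae (Filter.Eventually.of_forall fun ξ => by ring)


/-- The `n`-sum at the conjugate point: `Q(ξ, d) = ∑_{n∼N} b̄_n e(n d̄/c) e(ν_n · 2πξ)`. [folklore] -/
def Qsum (c : ℕ) (N : ℝ) (b : ℕ → ℂ) (ξ : ℝ) (d : ℕ) : ℂ :=
  ∑ n ∈ dyadic N, conj (b n) * e ((n : ℝ) * ((inv c d : ℝ) / c)) * e (logFreq n * (2 * π * ξ))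

/-- **Factorisation of `T(ξ)`** after opening the Kloosterman sum:
`T(ξ) = e(−2ξ log N) ∑*_d P(ξ, d) Q(ξ, d)`. [folklore] -/
theorem Tsum_eq {c : ℕ} (hc : 1 ≤ c) (N : ℝ) (b : ℕ → ℂ) (ξ : ℝ) :
    Tsum c N b ξ = e (-(2 * ξ * Real.log N)) * ∑ d ∈ units c, Psum c N b ξ d * Qsum c N b ξ d := by
  have hc0 : 0 < c := hc
  -- open the Kloosterman sum and split the character
  have hterm : ∀ m n : ℕ, b m * conj (b n) * kloo m n c *
      e ((Real.log m + Real.log n - 2 * Real.log N) * ξ) =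
      e (-(2 * ξ * Real.log N)) * ∑ d ∈ units c,
        (b m * e ((m : ℝ) * ((d : ℝ) / c)) * e (logFreq m * (2 * π * ξ))) *
        (conj (b n) * e ((n : ℝ) * ((inv c d : ℝ) / c)) * e (logFreq n * (2 * π * ξ))) := by
    intro m n
    rw [kloo_eq_sum_units (m : ℤ) (n : ℤ) hc0, fourierChar_logVar_mul]
    simp only [mul_sum, sum_mul]
    refine sum_congr rfl fun d _ => ?_
    push_cast
    ring
  calc Tsum c N b ξ
      = ∑ m ∈ dyadic N, ∑ n ∈ dyadic N, e (-(2 * ξ * Real.log N)) * ∑ d ∈ units c,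
          (b m * e ((m : ℝ) * ((d : ℝ) / c)) * e (logFreq m * (2 * π * ξ))) *
          (conj (b n) * e ((n : ℝ) * ((inv c d : ℝ) / c)) * e (logFreq n * (2 * π * ξ))) := by
        unfold Tsum
        exact sum_congr rfl fun m _ => sum_congr rfl fun n _ => hterm m n
    _ = e (-(2 * ξ * Real.log N)) * ∑ d ∈ units c, ∑ m ∈ dyadic N, ∑ n ∈ dyadic N,
          (b m * e ((m : ℝ) * ((d : ℝ) / c)) * e (logFreq m * (2 * π * ξ))) *
          (conj (b n) * e ((n : ℝ) * ((inv c d : ℝ) / c)) * e (logFreq n * (2 * π * ξ))) := by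
        simp only [mul_sum]
        conv_lhs => arg 2; ext m; rw [sum_comm]
        rw [sum_comm]
    _ = e (-(2 * ξ * Real.log N)) * ∑ d ∈ units c, Psum c N b ξ d * Qsum c N b ξ d := by
        congr 1
        refine sum_congr rfl fun d _ => ?_
        rw [Psum, Qsum, sum_mul_sum]

/-- `|Q(ξ, d)| = |P(−ξ, negInv d)|` (complex conjugation and `e(n d̄/c)‾ = e(n · negInv d/c)`). [folklore] -/
theorem norm_Qsum_eq {c : ℕ} (hc : 1 ≤ c) (N : ℝ) (b : ℕ → ℂ) (ξ : ℝ) (d : ℕ) :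
    ‖Qsum c N b ξ d‖ = ‖Psum c N b (-ξ) (negInv c d)‖ := by
  have hc0 : 0 < c := hc
  rw [← RCLike.norm_conj (Qsum c N b ξ d)]
  congr 1
  unfold Qsum Psum
  rw [map_sum]
  refine sum_congr rfl fun n _ => ?_
  rw [map_mul, map_mul, RCLike.conj_conj, conj_e, conj_e]
  have h := e_negInv hc0 d (n : ℤ)
  push_cast at h
  rw [h]
  congr 2
  ring

/-- **`|T(ξ)| ≤ (S(ξ) + S(−ξ))/2`**, `S(ξ) = ∑*_d |P(ξ, d)|²` (`|PQ| ≤ (|P|² + |Q|²)/2` and the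
reindexing `d ↦ −d̄` of the reduced residues for the `Q`-part). [folklore] -/
theorem norm_Tsum_le {c : ℕ} (hc : 1 ≤ c) (N : ℝ) (b : ℕ → ℂ) (ξ : ℝ) :
    ‖Tsum c N b ξ‖ ≤ (Ssum c N b ξ + Ssum c N b (-ξ)) / 2 := by
  have hc0 : 0 < c := hc
  rw [Tsum_eq hc, norm_mul, Circle.norm_coe, one_mul]
  have hQ : ∑ d ∈ units c, ‖Qsum c N b ξ d‖ ^ 2 = Ssum c N b (-ξ) := by
    unfold Ssum
    rw [← sum_units_negInv hc0 (fun d => ‖Psum c N b (-ξ) d‖ ^ 2)]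
    exact sum_congr rfl fun d _ => by rw [norm_Qsum_eq hc]
  calc ‖∑ d ∈ units c, Psum c N b ξ d * Qsum c N b ξ d‖
      ≤ ∑ d ∈ units c, ‖Psum c N b ξ d‖ * ‖Qsum c N b ξ d‖ :=
        (norm_sum_le _ _).trans (le_of_eq (sum_congr rfl fun d _ => norm_mul _ _))
    _ ≤ ∑ d ∈ units c, (‖Psum c N b ξ d‖ ^ 2 + ‖Qsum c N b ξ d‖ ^ 2) / 2 :=
        sum_le_sum fun d _ => by nlinarith [sq_nonneg (‖Psum c N b ξ d‖ - ‖Qsum c N b ξ d‖)]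
    _ = (Ssum c N b ξ + Ssum c N b (-ξ)) / 2 := by
        rw [← hQ, Ssum, ← sum_div, sum_add_distrib]

/-- **The hybrid large sieve for `S(ξ)`** (frequency `2πξ`): for `Ξ ≥ 1`,
`∫_{−Ξ}^{Ξ} S(ξ) dξ ≤ (π/2)(π e^π N + 4π c Ξ) ‖b‖²`. [cite: DeshouillersIwaniec1982, §5.1 (5.1)] -/
theorem integral_Ssum_le {c : ℕ} (hc : 1 ≤ c) {N : ℝ} (hN : 0 ≤ N) (b : ℕ → ℂ) {Ξ : ℝ} (hΞ : 1 ≤ Ξ) :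
    ∫ ξ in (-Ξ)..Ξ, Ssum c N b ξ ≤ π / 2 * (π * Real.exp π * N + 4 * π * c * Ξ) * l2 N b := by
  have hπ : 0 < π := Real.pi_pos
  have h2π : (0 : ℝ) < 2 * π := by positivity
  -- substitution `η = 2πξ`
  have hsub : ∫ ξ in (-Ξ)..Ξ, Ssum c N b ξ = (2 * π)⁻¹ * ∫ η in (-(2 * π * Ξ))..(2 * π * Ξ),
      ∑ d ∈ units c, ‖∑ m ∈ dyadic N, b m * e ((m : ℝ) * ((d : ℝ) / c)) * e (logFreq m * η)‖ ^ 2 := by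
    have h := intervalIntegral.integral_comp_mul_left (a := -Ξ) (b := Ξ)
      (fun η : ℝ => ∑ d ∈ units c, ‖∑ m ∈ dyadic N, b m * e ((m : ℝ) * ((d : ℝ) / c)) * e (logFreq m * η)‖ ^ 2)
      h2π.ne'
    simp only [smul_eq_mul] at h
    rw [show 2 * π * -Ξ = -(2 * π * Ξ) by ring] at h
    rw [← h]
    rfl
  rw [hsub]
  have hΞ' : 1 ≤ 2 * π * Ξ := by nlinarith [Real.pi_gt_three]
  have hLS := hybrid_largeSieve hc hN hΞ' b
  rw [inv_mul_le_iff₀ h2π]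
  refine hLS.trans (le_of_eq ?_)
  ring


/-! ### Integrating a weight `min(K₀, K₀Ξ₀²/ξ²)` against `S` by dyadic shells -/

/-- `∑_{j<J} (1/4)^j ≤ 4/3` and `∑_{j<J} (1/2)^j ≤ 2`. [folklore] -/
theorem geom_sums_le (J : ℕ) :
    ∑ j ∈ range J, ((1 : ℝ) / 4) ^ j ≤ 4 / 3 ∧ ∑ j ∈ range J, ((1 : ℝ) / 2) ^ j ≤ 2 := by
  constructor
  · rw [geom_sum_eq (by norm_num)]
    have : (0 : ℝ) ≤ ((1 : ℝ) / 4) ^ J := by positivity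
    rw [div_le_iff_of_neg (by norm_num)]
    linarith
  · rw [geom_sum_eq (by norm_num)]
    have : (0 : ℝ) ≤ ((1 : ℝ) / 2) ^ J := by positivity
    rw [div_le_iff_of_neg (by norm_num)]
    linarith

/-- **Dyadic shells.** Let `S ≥ 0`, `w` be continuous, `∫_{−Ξ}^{Ξ} S ≤ α + βΞ` for `Ξ ≥ Ξ₀ > 0`,
`w ≤ K₀` and `w(ξ) ξ² ≤ K₀ Ξ₀²`, and `S w` integrable.  Then `∫ S w ≤ K₀ (3α + 5βΞ₀)`: on the shell
`2^j Ξ₀ ≤ |ξ| ≤ 2^{j+1} Ξ₀` one has `w ≤ K₀ 4^{-j}`, and `∑_j 4^{-j}(α + β 2^{j+1} Ξ₀) ≤ 2α + 4βΞ₀`.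
[folklore] -/
theorem integral_mul_le_of_shells {S w : ℝ → ℝ} (hS : Continuous S) (hw : Continuous w)
    (hS0 : ∀ ξ, 0 ≤ S ξ) {Ξ₀ K₀ α β : ℝ} (hΞ₀ : 0 < Ξ₀) (hK₀ : 0 ≤ K₀)
    (hα : 0 ≤ α) (hβ : 0 ≤ β)
    (hF : ∀ Ξ, Ξ₀ ≤ Ξ → ∫ ξ in (-Ξ)..Ξ, S ξ ≤ α + β * Ξ)
    (hwK : ∀ ξ, w ξ ≤ K₀) (hwξ : ∀ ξ, w ξ * ξ ^ 2 ≤ K₀ * Ξ₀ ^ 2)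
    (hint : Integrable (fun ξ => S ξ * w ξ)) :
    ∫ ξ, S ξ * w ξ ≤ K₀ * (3 * α + 5 * β * Ξ₀) := by
  set R : ℕ → ℝ := fun j => 2 ^ j * Ξ₀ with hR
  have hR0 : ∀ j, 0 < R j := fun j => by positivity
  have hRmono : ∀ j, R j ≤ R (j + 1) := fun j => by
    simp only [hR, pow_succ]; nlinarith [pow_pos (two_pos : (0:ℝ) < 2) j]
  have hRsucc : ∀ j, R (j + 1) = 2 * R j := fun j => by simp only [hR, pow_succ]; ring
  have hSw_cont : Continuous fun ξ => S ξ * w ξ := hS.mul hw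
  have hii : ∀ a b' : ℝ, IntervalIntegrable (fun ξ => S ξ * w ξ) volume a b' :=
    fun a b' => hSw_cont.intervalIntegrable _ _
  have hiS : ∀ a b' : ℝ, IntervalIntegrable S volume a b' := fun a b' => hS.intervalIntegrable _ _
  -- the weight on the `j`-th shell
  have hwshell : ∀ j : ℕ, ∀ ξ : ℝ, R j ≤ |ξ| → w ξ ≤ K₀ / 4 ^ j := by
    intro j ξ hξ
    have hξ2 : (R j) ^ 2 ≤ ξ ^ 2 := by
      rw [← sq_abs ξ]; exact pow_le_pow_left₀ (hR0 j).le hξ 2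
    have hRj : (R j) ^ 2 = 4 ^ j * Ξ₀ ^ 2 := by
      simp only [hR]; rw [mul_pow, ← pow_mul, show (2:ℝ) ^ (j * 2) = 4 ^ j by
        rw [mul_comm, pow_mul]; norm_num]
    have h4 : (0 : ℝ) < 4 ^ j := by positivity
    rw [le_div_iff₀ h4]
    have hpos : 0 < ξ ^ 2 := lt_of_lt_of_le (by positivity) hξ2
    have := hwξ ξ
    calc w ξ * 4 ^ j = (w ξ * ξ ^ 2) * (4 ^ j / ξ ^ 2) := by
          rw [mul_div_assoc', mul_right_comm, mul_div_assoc, div_self hpos.ne', mul_one]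
      _ ≤ (K₀ * Ξ₀ ^ 2) * (4 ^ j / ξ ^ 2) := by gcongr
      _ = K₀ * ((4 ^ j * Ξ₀ ^ 2) / ξ ^ 2) := by ring
      _ ≤ K₀ * 1 := by
          refine mul_le_mul_of_nonneg_left ?_ hK₀
          rw [div_le_one hpos, ← hRj]; exact hξ2
      _ = K₀ := mul_one _
  -- the shell increments
  have hstep : ∀ J : ℕ, ∫ ξ in (-R (J + 1))..R (J + 1), S ξ * w ξ ≤
      (∫ ξ in (-R J)..R J, S ξ * w ξ) + K₀ / 4 ^ J * (α + β * R (J + 1)) := by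
    intro J
    have hsplit : ∫ ξ in (-R (J + 1))..R (J + 1), S ξ * w ξ =
        (∫ ξ in (-R (J + 1))..(-R J), S ξ * w ξ) + ((∫ ξ in (-R J)..R J, S ξ * w ξ) +
          ∫ ξ in (R J)..R (J + 1), S ξ * w ξ) := by
      rw [intervalIntegral.integral_add_adjacent_intervals (hii _ _) (hii _ _),
        intervalIntegral.integral_add_adjacent_intervals (hii _ _) (hii _ _)]
    have hright : ∫ ξ in (R J)..R (J + 1), S ξ * w ξ ≤ K₀ / 4 ^ J * ∫ ξ in (R J)..R (J + 1), S ξ := by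
      rw [← intervalIntegral.integral_const_mul]
      refine intervalIntegral.integral_mono_on (hRmono J) (hii _ _) ((hiS _ _).const_mul _) fun ξ hξ => ?_
      rw [mul_comm]
      refine mul_le_mul_of_nonneg_right (hwshell J ξ ?_) (hS0 ξ)
      rw [abs_of_pos ((hR0 J).trans_le hξ.1)]; exact hξ.1
    have hleft : ∫ ξ in (-R (J + 1))..(-R J), S ξ * w ξ ≤ K₀ / 4 ^ J * ∫ ξ in (-R (J + 1))..(-R J), S ξ := by
      rw [← intervalIntegral.integral_const_mul]
      refine intervalIntegral.integral_mono_on (by linarith [hRmono J]) (hii _ _) ((hiS _ _).const_mul _)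
        fun ξ hξ => ?_
      rw [mul_comm]
      refine mul_le_mul_of_nonneg_right (hwshell J ξ ?_) (hS0 ξ)
      rw [abs_of_neg (by linarith [hR0 J, hξ.2])]; linarith [hξ.2]
    have hSsplit : (∫ ξ in (-R (J + 1))..(-R J), S ξ) + ∫ ξ in (R J)..R (J + 1), S ξ ≤
        ∫ ξ in (-R (J + 1))..R (J + 1), S ξ := by
      rw [← intervalIntegral.integral_add_adjacent_intervals (hiS (-R (J + 1)) (-R J)) (hiS _ (R (J + 1))),
        ← intervalIntegral.integral_add_adjacent_intervals (hiS (-R J) (R J)) (hiS _ (R (J + 1)))]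
      have hmid : 0 ≤ ∫ ξ in (-R J)..R J, S ξ :=
        intervalIntegral.integral_nonneg (by linarith [hR0 J]) fun ξ _ => hS0 ξ
      linarith
    have hFR : ∫ ξ in (-R (J + 1))..R (J + 1), S ξ ≤ α + β * R (J + 1) := by
      refine hF _ ?_
      have : Ξ₀ ≤ R (J + 1) := by
        simp only [hR]
        have : (1 : ℝ) ≤ 2 ^ (J + 1) := one_le_pow₀ (by norm_num)
        nlinarith
      exact this
    have hK4 : 0 ≤ K₀ / 4 ^ J := by positivity
    rw [hsplit]
    nlinarith [mul_le_mul_of_nonneg_left (hSsplit.trans hFR) hK4]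
  -- the bound on the truncated integrals
  have hbound : ∀ J : ℕ, ∫ ξ in (-R J)..R J, S ξ * w ξ ≤
      K₀ * (α + β * Ξ₀) + K₀ * (α * ∑ j ∈ range J, ((1 : ℝ) / 4) ^ j +
        2 * β * Ξ₀ * ∑ j ∈ range J, ((1 : ℝ) / 2) ^ j) := by
    intro J
    induction J with
    | zero =>
      simp only [range_zero, sum_empty, mul_zero, add_zero]
      have h0 : R 0 = Ξ₀ := by simp [hR]
      rw [h0]
      calc ∫ ξ in (-Ξ₀)..Ξ₀, S ξ * w ξ ≤ ∫ ξ in (-Ξ₀)..Ξ₀, K₀ * S ξ := by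
            refine intervalIntegral.integral_mono_on (by linarith) (hii _ _) ((hiS _ _).const_mul _)
              fun ξ _ => ?_
            rw [mul_comm]; exact mul_le_mul_of_nonneg_right (hwK ξ) (hS0 ξ)
        _ = K₀ * ∫ ξ in (-Ξ₀)..Ξ₀, S ξ := intervalIntegral.integral_const_mul _ _
        _ ≤ K₀ * (α + β * Ξ₀) := mul_le_mul_of_nonneg_left (hF Ξ₀ le_rfl) hK₀
    | succ J ih =>
      refine (hstep J).trans ?_
      rw [sum_range_succ, sum_range_succ, hRsucc]
      have e1 : K₀ / 4 ^ J * (α + β * (2 * R J)) = K₀ * (α * (1 / 4) ^ J + 2 * β * Ξ₀ * (1 / 2) ^ J) := by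
        simp only [hR]
        rw [one_div_pow, one_div_pow, show (4 : ℝ) ^ J = 2 ^ J * 2 ^ J by rw [← mul_pow]; norm_num]
        field_simp
      rw [e1]
      nlinarith
  -- uniform bound and limit
  have hunif : ∀ J : ℕ, ∫ ξ in (-R J)..R J, S ξ * w ξ ≤ K₀ * (3 * α + 5 * β * Ξ₀) := by
    intro J
    refine (hbound J).trans ?_
    obtain ⟨g4, g2⟩ := geom_sums_le J
    have e1 : α * ∑ j ∈ range J, ((1 : ℝ) / 4) ^ j ≤ α * 2 := mul_le_mul_of_nonneg_left (by linarith) hα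
    have e2 : 2 * β * Ξ₀ * ∑ j ∈ range J, ((1 : ℝ) / 2) ^ j ≤ 2 * β * Ξ₀ * 2 :=
      mul_le_mul_of_nonneg_left g2 (by positivity)
    nlinarith [mul_le_mul_of_nonneg_left (add_le_add e1 e2) hK₀]
  have htend : Filter.Tendsto (fun J : ℕ => ∫ ξ in (-R J)..R J, S ξ * w ξ) Filter.atTop
      (nhds (∫ ξ, S ξ * w ξ)) := by
    have hRtop : Filter.Tendsto R Filter.atTop Filter.atTop := by
      refine Filter.tendsto_atTop_atTop.2 fun M => ⟨⌈M / Ξ₀⌉₊, fun J hJ => ?_⟩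
      simp only [hR]
      have h1 : M / Ξ₀ ≤ J := (Nat.le_ceil _).trans (by exact_mod_cast hJ)
      have h2 : (J : ℝ) ≤ 2 ^ J := by exact_mod_cast (Nat.lt_two_pow_self).le
      rw [div_le_iff₀ hΞ₀] at h1
      nlinarith
    exact intervalIntegral_tendsto_integral hint (Filter.tendsto_neg_atTop_atBot.comp hRtop) hRtop
  exact le_of_tendsto' htend hunif


/-! ### (1.26): the large-sieve bound -/

/-- The absolute constant of (1.26): `A = 20 π² e^π max(4, C/π²)`, `C = M + 2Mβ + β² + β` with `M`
the bound for `ρ', ρ''` of `exists_rho_deriv_bound` and `β = π e²`. [folklore] -/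
def quadBLSConst : ℝ :=
  20 * π ^ 2 * Real.exp π *
    max 4 ((Classical.choose exists_rho_deriv_bound + 2 * Classical.choose exists_rho_deriv_bound * betaL +
      betaL ^ 2 + betaL) / π ^ 2)

/-- `quadBLSConst > 0`. [folklore] -/
theorem quadBLSConst_pos : 0 < quadBLSConst := by
  unfold quadBLSConst
  refine mul_pos (by positivity) (lt_max_of_lt_left (by norm_num))

/-- **(1.26)** [DeshouillersIwaniec1982, Proposition 3 (1.26): `|B(θ, c, N)| ≪ (c + N + √(θcN)) ‖b‖²`],
here in the form `‖B(θ, c, N)‖ ≤ A (c + N + |θ| N) ‖b‖²` (`c ≥ 1`, `N ≥ 1/2`, any real `θ`) with the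
absolute constant `A = quadBLSConst`.  Proof: `B = ∫ 𝓕G_κ(ξ) T(ξ) dξ` (`quadB_eq_integral`),
`|T(ξ)| ≤ (S(ξ) + S(−ξ))/2` (`norm_Tsum_le`), the hybrid large sieve `∫_{−Ξ}^{Ξ} S ≤ (π/2)(πe^πN + 4πcΞ)‖b‖²`
(`integral_Ssum_le`), `|𝓕G_κ| ≤ 4`, `|𝓕G_κ(ξ)| ξ² ≤ (C/π²)(1 + |κ|)²` and the dyadic shells
(`integral_mul_le_of_shells` with `Ξ₀ = 1 + |κ|`, `κ = 2θN/c`, `c|κ| = 2|θ|N`).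
[cite: DeshouillersIwaniec1982, Proposition 3 (1.26)] -/
theorem norm_quadB_le_largeSieve (θ : ℝ) {c : ℕ} (hc : 1 ≤ c) {N : ℝ} (hN : 1 / 2 ≤ N) (b : ℕ → ℂ) :
    ‖quadB θ c N b‖ ≤ quadBLSConst * (c + N + |θ| * N) * l2 N b := by
  have hN0 : 0 < N := by linarith
  have hc0 : (0 : ℝ) < c := by exact_mod_cast hc
  have hπ : 0 < π := Real.pi_pos
  -- the constants
  have hMspec := Classical.choose_spec exists_rho_deriv_bound
  set M : ℝ := Classical.choose exists_rho_deriv_bound with hM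
  obtain ⟨hM0, hM1, hM2⟩ := hMspec
  set C : ℝ := M + 2 * M * betaL + betaL ^ 2 + betaL with hC
  have hβ0 : 0 ≤ betaL := by unfold betaL; positivity
  have hC0 : 0 ≤ C := by rw [hC]; positivity
  set K₀ : ℝ := max 4 (C / π ^ 2) with hK₀
  have hK₀0 : 0 ≤ K₀ := le_max_of_le_left (by norm_num)
  have hA : quadBLSConst = 20 * π ^ 2 * Real.exp π * K₀ := rfl
  set κ : ℝ := 2 * θ * N / c with hκ
  set Ξ₀ : ℝ := 1 + |κ| with hΞ₀
  have hΞ₀1 : 1 ≤ Ξ₀ := by rw [hΞ₀]; linarith [abs_nonneg κ]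
  set w : ℝ → ℝ := fun ξ => ‖𝓕 (G κ) ξ‖ with hw
  set S : ℝ → ℝ := Ssum c N b with hSdef
  set L : ℝ := l2 N b with hL
  have hL0 : 0 ≤ L := l2_nonneg N b
  set α : ℝ := π ^ 2 * Real.exp π / 2 * N * L with hα
  set β : ℝ := 2 * π ^ 2 * c * L with hβ
  have hα0 : 0 ≤ α := by positivity
  have hβ0' : 0 ≤ β := by positivity
  -- the hypotheses of the shell lemma
  have hScont : Continuous S := continuous_Ssum c N b
  have hwcont : Continuous w := (continuous_fourier_G κ).norm
  have hS0 : ∀ ξ, 0 ≤ S ξ := Ssum_nonneg c N b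
  have hF : ∀ Ξ, Ξ₀ ≤ Ξ → ∫ ξ in (-Ξ)..Ξ, S ξ ≤ α + β * Ξ := by
    intro Ξ hΞ
    refine (integral_Ssum_le hc hN0.le b (hΞ₀1.trans hΞ)).trans (le_of_eq ?_)
    rw [hα, hβ]; ring
  have hwK : ∀ ξ, w ξ ≤ K₀ := fun ξ => (norm_fourier_G_le κ ξ).trans (le_max_left _ _)
  have hwξ : ∀ ξ, w ξ * ξ ^ 2 ≤ K₀ * Ξ₀ ^ 2 := by
    intro ξ
    have h := sq_mul_norm_fourier_G_le hM0 hM1 hM2 κ ξ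
    rw [← hC] at h
    have h2 : (2 * π * |ξ|) ^ 2 = 4 * π ^ 2 * ξ ^ 2 := by rw [mul_pow, mul_pow, sq_abs]; ring
    rw [h2] at h
    have h3 : w ξ * ξ ^ 2 ≤ C / π ^ 2 * Ξ₀ ^ 2 := by
      rw [div_mul_eq_mul_div, le_div_iff₀ (by positivity)]
      rw [hΞ₀]; nlinarith [norm_nonneg (𝓕 (G κ) ξ)]
    exact h3.trans (mul_le_mul_of_nonneg_right (le_max_right _ _) (by positivity))
  -- `S` is bounded, so `S w` and `S(−·) w` are integrable
  have hSbdd : ∀ ξ, ‖S ξ‖ ≤ (units c).card * (∑ m ∈ dyadic N, ‖b m‖) ^ 2 := by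
    intro ξ
    rw [Real.norm_of_nonneg (hS0 ξ), hSdef, Ssum]
    calc ∑ d ∈ units c, ‖Psum c N b ξ d‖ ^ 2 ≤ ∑ d ∈ units c, (∑ m ∈ dyadic N, ‖b m‖) ^ 2 := by
          refine sum_le_sum fun d _ => pow_le_pow_left₀ (norm_nonneg _) ?_ 2
          unfold Psum
          refine (norm_sum_le _ _).trans (sum_le_sum fun m _ => ?_)
          rw [norm_mul, norm_mul, norm_e, norm_e, mul_one, mul_one]
      _ = (units c).card * (∑ m ∈ dyadic N, ‖b m‖) ^ 2 := by rw [sum_const, nsmul_eq_mul]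
  have hint : Integrable (fun ξ => S ξ * w ξ) :=
    (integrable_fourier_G κ).norm.bdd_mul hScont.aestronglyMeasurable (Filter.Eventually.of_forall hSbdd)
  have hS'cont : Continuous fun ξ => S (-ξ) := hScont.comp continuous_neg
  have hint' : Integrable (fun ξ => S (-ξ) * w ξ) :=
    (integrable_fourier_G κ).norm.bdd_mul hS'cont.aestronglyMeasurable
      (Filter.Eventually.of_forall fun ξ => hSbdd (-ξ))
  have hF' : ∀ Ξ, Ξ₀ ≤ Ξ → ∫ ξ in (-Ξ)..Ξ, S (-ξ) ≤ α + β * Ξ := by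
    intro Ξ hΞ
    rw [intervalIntegral.integral_comp_neg, neg_neg]
    exact hF Ξ hΞ
  have hmain := integral_mul_le_of_shells hScont hwcont hS0 (by linarith) hK₀0 hα0 hβ0' hF hwK hwξ hint
  have hmain' := integral_mul_le_of_shells hS'cont hwcont (fun ξ => hS0 (-ξ)) (by linarith) hK₀0 hα0 hβ0'
    hF' hwK hwξ hint'
  -- `‖B‖ ≤ (∫ S w + ∫ S(−·) w)/2`
  have hB : ‖quadB θ c N b‖ ≤ ((∫ ξ, S ξ * w ξ) + ∫ ξ, S (-ξ) * w ξ) / 2 := by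
    rw [quadB_eq_integral hN0 hc b, ← hκ]
    have h1 : ‖∫ ξ, 𝓕 (G κ) ξ * Tsum c N b ξ‖ ≤ ∫ ξ, (1 / 2) * (S ξ * w ξ) + (1 / 2) * (S (-ξ) * w ξ) := by
      refine (norm_integral_le_integral_norm _).trans (integral_mono_of_nonneg
        (Filter.Eventually.of_forall fun ξ => norm_nonneg _) ((hint.const_mul _).add (hint'.const_mul _))
        (Filter.Eventually.of_forall fun ξ => ?_))
      dsimp only
      rw [norm_mul]
      have := mul_le_mul_of_nonneg_left (norm_Tsum_le hc N b ξ) (norm_nonneg (𝓕 (G κ) ξ))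
      refine this.trans (le_of_eq ?_)
      simp only [hw]; ring
    refine h1.trans (le_of_eq ?_)
    rw [integral_add (hint.const_mul _) (hint'.const_mul _), integral_const_mul, integral_const_mul]
    ring
  calc ‖quadB θ c N b‖ ≤ ((∫ ξ, S ξ * w ξ) + ∫ ξ, S (-ξ) * w ξ) / 2 := hB
    _ ≤ K₀ * (3 * α + 5 * β * Ξ₀) := by linarith
    _ = K₀ * L * (3 * (π ^ 2 * Real.exp π / 2) * N + 10 * π ^ 2 * c + 10 * π ^ 2 * (c * |κ|)) := by
        rw [hα, hβ, hΞ₀]; ring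
    _ = K₀ * L * (3 * (π ^ 2 * Real.exp π / 2) * N + 10 * π ^ 2 * c + 10 * π ^ 2 * (2 * |θ| * N)) := by
        congr 2
        rw [hκ, abs_div, abs_mul, abs_mul, Nat.abs_cast, abs_of_pos hN0, abs_two]
        field_simp
    _ ≤ K₀ * L * (20 * π ^ 2 * Real.exp π * (c + N + |θ| * N)) := by
        refine mul_le_mul_of_nonneg_left ?_ (by positivity)
        have he : (1 : ℝ) ≤ Real.exp π := Real.one_le_exp hπ.le
        have hπ2 : 0 < π ^ 2 := by positivity
        have hθ : 0 ≤ |θ| * N := by positivity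
        nlinarith [mul_le_mul_of_nonneg_left he hπ2.le, mul_nonneg hπ2.le hθ, mul_nonneg hπ2.le hN0.le,
          mul_nonneg hπ2.le hc0.le, mul_nonneg (mul_nonneg hπ2.le (Real.exp_pos π).le) hθ,
          mul_nonneg (mul_nonneg hπ2.le (Real.exp_pos π).le) hc0.le]
    _ = quadBLSConst * (c + N + |θ| * N) * l2 N b := by rw [hA, hL]; ring


end DeshouillersIwaniec

end Literature.NumberTheory.Sieve
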